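import Literature.NumberTheory.ConnesConsani2021.QuasiInnerProductResidues
import Literature.NumberTheory.ConnesConsani2021.QuasiInnerPrimePolarPart
import HarnessLib

/-!
# Connes–Consani 2021 (JNT) Proposition 4.5 — `κκ_p ∈ C(S¹) + H^∞(𝒰)`: the bounded holomorphic remainder
# (discharge of the named fact `QuasiInner.prop_4_5`)

LINE 1 — LABEL: RH-FREE corpus literature (function theory of the product `ρ_∞ρ_p` of the archimedean and the
`p`-adic ratio of local factors, to the left of and on the critical line; no positivity statement, no statement
about zeros of `ζ`); bears_on: W-C/W-P (sequel typing, no leaf/binder role); WHAT THIS IS NOT: any claim about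
RH — nothing in this file bears on the truth of RH.

Source: A. Connes, C. Consani, *Quasi-inner functions and local factors*, J. Number Theory **226** (2021)
139–167 = arXiv:2008.10974 [bib: `ConnesConsani2021QuasiInner`]; locators are arXiv tex chunks `pNNNN:Lnn` of the
held text `paper:arxiv-2008.10974` (page-read for this file: Prop. 4.5 and its proof, p0013:L5–L52; proof of
Thm. 4.4 (ii), p0011:L100–p0012:L18).  Written by seat rh-crit-cc-t16 (g3).  THEOREMS ONLY (no `def`, no new named
fact); net debt −1 (`prop_4_5_holds`).  Vocabulary: `QuasiInnerLocalFactors.lean` (t17: `rhoArch`, `rhoPrime`,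
`cayley`, `kappaArch`, `kappaPrime`), `QuasiInnerProducts.lean` (t18: the named fact `prop_4_5`, `thm23Coeff`),
`QuasiInnerPrimePolarPart.lean` (t18: `primePole`, `primePolarTerm`, `primePolarPart` = the printed `φ`,
`circlePullback`, the pullback principle `continuous_circlePullback`, the uniform bounds of §11),
`QuasiInnerProductResidues.lean` / `QuasiInnerPrimeResidues.lean` (t5: `ρ_p` near its poles, `|ρ_p| ≤ 1` on the
half-lattice lines), `QuasiInnerArchResidues.lean` (t17: `ρ_∞ = Φ/(z+2n)` near `−2n`) and
`QuasiInnerArchDiscResidues.lean` (this seat: `exists_norm_rhoArch_le`, `re_cayley_le`, `differentiableAt_cayley`).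

## The printed proof and how it is formalised

Print (p0013:L7–L52): the polar part of `k(v) = κ(v)κ_p(v)` is `Φ = φ + φ₁ + φ₂` — `φ` from the poles
`2πin/log p` (`n ≠ 0`) of `ρ_p` weighted by `ρ_∞(2πin/log p) = O(n^{−1/2})`, `φ₁` from the poles `−2n` (`n ≥ 1`) of
`ρ_∞` weighted by `ρ_p(−2n)`, `φ₂` from the double pole at `0`; `Φ∘ψ ∈ C(S¹)`; the remainder is holomorphic in
the disc and bounded (print: via the uniform bounds on the contours `C_{R,m}`, `R = (2m+1)π/log p`, Cauchy's
formula, `b_{−k} = a_{−k}`, `H²` and the Cauchy integral).  Here, in the `z`-plane: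

* **B.** polar sums `Σ_n c_n/(z + 2(n+1))` with `Σ|c_n| < ∞` (the shape of `φ₁`): holomorphic off the poles,
  removable behaviour minus one term, uniform bound at distance `≥ δ` from the poles, decay along the critical line;
* **C.** `φ` is holomorphic off its poles (local domination: finitely many near poles, `|n|^{−3/2}` tail), removable
  behaviour minus one term, bounded on the critical line;
* **D.** the three kinds of poles of `ρ_∞ρ_p`: principal parts and limits of the remainders
  (`exists_tendsto_product_sub_primePole/_archPole/_doublePole`);
* **E.** the pole set is uniformly discrete (closed, isolated points); the remainder `E = ρ_∞ρ_p − Φ` is holomorphic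
  off it (`differentiableAt_productRemainder`);
* **F.** `E` is bounded on the boundaries of the printed rectangles `(½−2m, ½) × (−R, R)`, `R = (2m′+1)π/log p`,
  uniformly (`exists_bound_productRemainder_frontier`: `|ρ_∞| ≤ C` on `ℂ₋` off `2ℤ`, `|ρ_p| ≤ 1` on the half-lattice
  lines and the critical line and `≤ (1+p⁻¹)/(p^{3/2}−1)` on `Re z ≤ −3/2`, `φ` by t18's §11, `φ₁`, `φ₂` since
  `|z + 2n| ≥ ½`, `|z| ≥ ½`);
* **G.** `prop_4_5_holds`: `E` extends to an entire function `Ẽ` (removable singularities); `h := Ẽ∘ψ` is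
  holomorphic on the disc and bounded by the maximum modulus principle on the rectangles (exhausting `Re z ≤ ½`);
  `c := Φ∘ψ` (value `0` at `v = 1`) is continuous and `1`-periodic; radial limits at `e^{2πix} ≠ 1` by continuity.

Deviations from print, declared: (i) boundedness of the remainder by the maximum modulus principle on the printed
rectangles instead of «negative Fourier modes vanish ⇒ `H²` ⇒ Cauchy integral» (same statement); (ii) the
coefficients of `φ₂ = a z⁻² + b z⁻¹` are the true Laurent data at `0` obtained by two divided differences — the typed
`prop_4_5` quantifies `c` existentially, so the printed closed form of `b` (with `γ`, `Γ′/Γ(½)`) is not needed and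
not asserted; (iii) the coefficients of `φ₁` are `ρ_p(−2n)·Res_{−2n}ρ_∞` = the FIRST expression of display φ₁
(p0013:L47–L48); the second printed expression (with `(4n+1)^{−1}` and the sign of (4.3)) is the operator
coefficient of Thm 4.4 (ii), not the residue — recorded, not used.

Nothing in this file bears on the truth of RH.
-/

noncomputable section

open _root_.MeasureTheory _root_.Complex Filter Set Metric
open scoped Real Topology Nat

namespace Literature.NumberTheory.ConnesConsani2021

namespace QuasiInner

/-! ### A. Elementary helpers -/

/-- RH-FREE. A uniform positive lower bound (`≤ 1`) for finitely many positive reals. [folklore] -/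
private theorem exists_pos_le_finset {ι : Type*} (s : Finset ι) (f : ι → ℝ) (h : ∀ i ∈ s, 0 < f i) :
    ∃ c : ℝ, 0 < c ∧ c ≤ 1 ∧ ∀ i ∈ s, c ≤ f i := by
  classical
  induction s using Finset.induction_on with
  | empty => exact ⟨1, one_pos, le_rfl, fun i hi => by simp at hi⟩
  | insert a s ha ih =>
    obtain ⟨c, hc0, hc1, hcs⟩ := ih fun i hi => h i (Finset.mem_insert_of_mem hi)
    refine ⟨min c (f a), lt_min hc0 (h a (Finset.mem_insert_self a s)), (min_le_left _ _).trans hc1, ?_⟩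
    intro i hi
    rcases Finset.mem_insert.mp hi with rfl | hi
    · exact min_le_right _ _
    · exact (min_le_left _ _).trans (hcs i hi)

/-- RH-FREE. A continuous function `ℝ → ℂ` tending to `0` at `±∞` is bounded. [folklore] -/
private theorem exists_bound_of_tendsto_cocompact {f : ℝ → ℂ} (hf : Continuous f)
    (h0 : Tendsto f (cocompact ℝ) (𝓝 0)) : ∃ C : ℝ, ∀ s : ℝ, ‖f s‖ ≤ C := by
  have hev : ∀ᶠ s in cocompact ℝ, ‖f s‖ ≤ 1 := by
    have h1 := h0.norm
    rw [norm_zero] at h1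
    exact h1 (Iic_mem_nhds one_pos)
  obtain ⟨K, hK, hKs⟩ := mem_cocompact.mp hev
  obtain ⟨C, hC⟩ := hK.exists_bound_of_continuousOn hf.continuousOn
  refine ⟨max C 1, fun s => ?_⟩
  by_cases hs : s ∈ K
  · exact (hC s hs).trans (le_max_left _ _)
  · exact le_trans (hKs hs) (le_max_right _ _)

/-! ### B. Polar sums at the poles `−2(n+1)` with absolutely summable coefficients

The polar part of `ρ_∞ρ_p` at the non-zero poles `−2n` of `ρ_∞` is `φ₁(z) = Σ_{n≥1} ρ_p(−2n) r_n/(z + 2n)`,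
`r_n = Res_{−2n} ρ_∞` (p0013:L47–L48, first expression).  We treat such sums for an arbitrary absolutely summable
coefficient sequence `c`. -/

/-- RH-FREE. Near a point which is not one of the poles `−2(n+1)`, `n ≠ k`, the denominators `w + 2(n+1)`,
`n ≠ k`, are uniformly bounded below. [folklore] -/
private theorem exists_ball_denominators_ge (z : ℂ) (k : ℕ)
    (hz : ∀ n : ℕ, n ≠ k → z ≠ -(2 * ((n : ℂ) + 1))) :
    ∃ r c : ℝ, 0 < r ∧ 0 < c ∧ c ≤ 1 ∧
      ∀ n : ℕ, n ≠ k → ∀ w ∈ ball z r, c ≤ ‖w + 2 * ((n : ℂ) + 1)‖ := by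
  set K : ℕ := ⌈‖z‖⌉₊ + 1 with hK
  obtain ⟨c, hc0, hc1, hcs⟩ := exists_pos_le_finset ((Finset.range K).filter (fun n => n ≠ k))
    (fun n => ‖z + 2 * ((n : ℂ) + 1)‖) (by
      intro n hn
      have hnk : n ≠ k := (Finset.mem_filter.mp hn).2
      exact norm_pos_iff.mpr (fun h => hz n hnk (by linear_combination h)))
  refine ⟨c / 2, c / 2, by positivity, by positivity, by linarith, fun n hnk w hw => ?_⟩
  rw [mem_ball, dist_eq_norm] at hw
  by_cases hn : n < K
  · have h1 := hcs n (Finset.mem_filter.mpr ⟨Finset.mem_range.mpr hn, hnk⟩)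
    have h2 : ‖z + 2 * ((n : ℂ) + 1)‖ - ‖w - z‖ ≤ ‖w + 2 * ((n : ℂ) + 1)‖ := by
      have := norm_sub_norm_le (z + 2 * ((n : ℂ) + 1)) (z - w)
      rw [show z + 2 * ((n : ℂ) + 1) - (z - w) = w + 2 * ((n : ℂ) + 1) by ring] at this
      rw [norm_sub_rev w z]
      simpa using this
    linarith
  · push Not at hn
    have hKz : ‖z‖ ≤ K := by
      rw [hK]; push_cast; linarith [Nat.le_ceil ‖z‖]
    have hnR : (K : ℝ) ≤ n := by exact_mod_cast hn
    have h3 : 2 * ((n : ℝ) + 1) - ‖w‖ ≤ ‖w + 2 * ((n : ℂ) + 1)‖ := by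
      have := norm_sub_norm_le (2 * ((n : ℂ) + 1)) (-w)
      rw [norm_neg, show (2 * ((n : ℂ) + 1)) - -w = w + 2 * ((n : ℂ) + 1) by ring] at this
      have e : ‖(2 * ((n : ℂ) + 1))‖ = 2 * ((n : ℝ) + 1) := by
        rw [show (2 * ((n : ℂ) + 1)) = ((2 * ((n : ℝ) + 1) : ℝ) : ℂ) by push_cast; ring, Complex.norm_real,
          Real.norm_eq_abs, abs_of_pos (by positivity)]
      linarith
    have h4 : ‖w‖ ≤ ‖z‖ + ‖w - z‖ := norm_le_insert' w z
    linarith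

/-- RH-FREE. **Holomorphy of a polar sum `Σ_n c_n/(w + 2(n+1))` (`Σ|c_n| < ∞`) near every point which is not
a pole, one index `k` excluded** (uniform domination on a small ball). [cite: ConnesConsani2021QuasiInner, Prop 4.5 proof, display φ₁ (arXiv chunk p0013:L47–L51)] -/
theorem exists_ball_differentiableOn_archPolarSum_ite {c : ℕ → ℂ} (hc : Summable fun n => ‖c n‖) (z : ℂ) (k : ℕ)
    (hz : ∀ n : ℕ, n ≠ k → z ≠ -(2 * ((n : ℂ) + 1))) :
    ∃ r > 0, DifferentiableOn ℂ (fun w : ℂ => ∑' n : ℕ, if n = k then (0 : ℂ) else c n / (w + 2 * ((n : ℂ) + 1)))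
        (ball z r) ∧
      ∀ w ∈ ball z r, Summable fun n : ℕ => if n = k then (0 : ℂ) else c n / (w + 2 * ((n : ℂ) + 1)) := by
  obtain ⟨r, δ, hr, hδ, -, hden⟩ := exists_ball_denominators_ge z k hz
  have hbound : ∀ n : ℕ, ∀ w ∈ ball z r,
      ‖(if n = k then (0 : ℂ) else c n / (w + 2 * ((n : ℂ) + 1)))‖ ≤ ‖c n‖ / δ := by
    intro n w hw
    split_ifs with hnk
    · rw [norm_zero]; positivity
    · rw [norm_div]; exact div_le_div_of_nonneg_left (norm_nonneg _) hδ (hden n hnk w hw)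
  refine ⟨r, hr, ?_, fun w hw => Summable.of_norm_bounded (hc.div_const δ) (fun n => hbound n w hw)⟩
  refine differentiableOn_tsum_of_summable_norm (u := fun n => ‖c n‖ / δ) (hc.div_const δ) (fun n => ?_)
    isOpen_ball hbound
  by_cases hnk : n = k
  · simp only [hnk, if_true]; exact differentiableOn_const _
  · simp only [hnk, if_false]
    apply DifferentiableOn.div (differentiableOn_const _) (differentiableOn_id.add (differentiableOn_const _))
    intro w hw h0
    have := hden n hnk w hw
    rw [h0, norm_zero] at this
    linarith

/-- RH-FREE. A polar sum `Σ_n c_n/(w + 2(n+1))` with `Σ|c_n| < ∞` is holomorphic off its poles.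
[cite: ConnesConsani2021QuasiInner, Prop 4.5 proof, display φ₁ (arXiv chunk p0013:L47–L51)] -/
theorem differentiableAt_archPolarSum {c : ℕ → ℂ} (hc : Summable fun n => ‖c n‖) {z : ℂ}
    (hz : ∀ n : ℕ, z ≠ -(2 * ((n : ℂ) + 1))) :
    DifferentiableAt ℂ (fun w : ℂ => ∑' n : ℕ, c n / (w + 2 * ((n : ℂ) + 1))) z := by
  obtain ⟨r, hr, hdiff, hsum⟩ := exists_ball_differentiableOn_archPolarSum_ite hc z 0 (fun n _ => hz n)
  have hball : ball z r ∈ 𝓝 z := isOpen_ball.mem_nhds (mem_ball_self hr)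
  have h0 : DifferentiableAt ℂ (fun w : ℂ => c 0 / (w + 2 * (((0:ℕ) : ℂ) + 1))) z :=
    (differentiableAt_const _).div (differentiableAt_id.add (differentiableAt_const _)) (by
      intro h; exact hz 0 (by linear_combination h))
  have heq : (fun w : ℂ => ∑' n : ℕ, c n / (w + 2 * ((n : ℂ) + 1))) =ᶠ[𝓝 z]
      fun w => c 0 / (w + 2 * (((0:ℕ) : ℂ) + 1)) + ∑' n : ℕ, if n = 0 then (0 : ℂ) else c n / (w + 2 * ((n : ℂ) + 1)) := by
    filter_upwards [hball] with w hw
    have hs : Summable (Function.update (fun n : ℕ => c n / (w + 2 * ((n : ℂ) + 1))) 0 0) := by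
      refine (hsum w hw).congr fun n => ?_
      rw [Function.update_apply]
    exact Summable.tsum_eq_add_tsum_ite' 0 hs
  exact (h0.add (hdiff.differentiableAt hball)).congr_of_eventuallyEq heq

/-- RH-FREE. **Removable behaviour of a polar sum at its pole `−2(k+1)`**: `Σ_n c_n/(w + 2(n+1)) − c_k/(w + 2(k+1))`
has a limit as `w → −2(k+1)`. [cite: ConnesConsani2021QuasiInner, Prop 4.5 proof, display φ₁ (arXiv chunk p0013:L47–L51)] -/
theorem exists_tendsto_archPolarSum_sub {c : ℕ → ℂ} (hc : Summable fun n => ‖c n‖) (k : ℕ) :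
    ∃ L : ℂ, Tendsto (fun w : ℂ => ∑' n : ℕ, c n / (w + 2 * ((n : ℂ) + 1)) - c k / (w + 2 * ((k : ℂ) + 1)))
      (𝓝[≠] (-(2 * ((k : ℂ) + 1)))) (𝓝 L) := by
  set q : ℂ := -(2 * ((k : ℂ) + 1)) with hq
  have hqn : ∀ n : ℕ, n ≠ k → q ≠ -(2 * ((n : ℂ) + 1)) := by
    intro n hn h
    apply hn
    have : ((n : ℂ)) = k := by rw [hq] at h; linear_combination h / 2
    exact_mod_cast this
  obtain ⟨r, hr, hdiff, hsum⟩ := exists_ball_differentiableOn_archPolarSum_ite hc q k hqn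
  have hball : ball q r ∈ 𝓝 q := isOpen_ball.mem_nhds (mem_ball_self hr)
  set G : ℂ → ℂ := fun w => ∑' n : ℕ, if n = k then (0 : ℂ) else c n / (w + 2 * ((n : ℂ) + 1)) with hG
  have hGc : ContinuousAt G q := (hdiff.differentiableAt hball).continuousAt
  refine ⟨G q, (hGc.tendsto.mono_left nhdsWithin_le_nhds).congr' ?_⟩
  filter_upwards [mem_nhdsWithin_of_mem_nhds hball] with w hw
  have hs : Summable (Function.update (fun n : ℕ => c n / (w + 2 * ((n : ℂ) + 1))) k 0) := by
    refine (hsum w hw).congr fun n => ?_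
    rw [Function.update_apply]
  rw [Summable.tsum_eq_add_tsum_ite' k hs]
  simp only [hG]
  ring

/-- RH-FREE. **Uniform bound of a polar sum away from its poles**: if all denominators have norm `≥ δ` then
`|Σ c_n/(z + 2(n+1))| ≤ (Σ|c_n|)/δ` («`|z + 2n| ≥ ½` … on the contour `C_{R,m}` … bounded independently of `m`»).
[cite: ConnesConsani2021QuasiInner, Prop 4.5 proof (arXiv chunk p0013:L51–L52)] -/
theorem norm_archPolarSum_le {c : ℕ → ℂ} (hc : Summable fun n => ‖c n‖) {z : ℂ} {δ : ℝ} (hδ : 0 < δ)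
    (hz : ∀ n : ℕ, δ ≤ ‖z + 2 * ((n : ℂ) + 1)‖) :
    ‖∑' n : ℕ, c n / (z + 2 * ((n : ℂ) + 1))‖ ≤ (∑' n : ℕ, ‖c n‖) / δ := by
  have hb : ∀ n, ‖c n / (z + 2 * ((n : ℂ) + 1))‖ ≤ ‖c n‖ / δ := fun n => by
    rw [norm_div]; exact div_le_div_of_nonneg_left (norm_nonneg _) hδ (hz n)
  have hs : Summable fun n => ‖c n / (z + 2 * ((n : ℂ) + 1))‖ :=
    Summable.of_nonneg_of_le (fun _ => norm_nonneg _) hb (hc.div_const δ)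
  calc ‖∑' n : ℕ, c n / (z + 2 * ((n : ℂ) + 1))‖ ≤ ∑' n, ‖c n / (z + 2 * ((n : ℂ) + 1))‖ :=
        norm_tsum_le_tsum_norm hs
    _ ≤ ∑' n, ‖c n‖ / δ := Summable.tsum_le_tsum hb hs (hc.div_const δ)
    _ = (∑' n : ℕ, ‖c n‖) / δ := tsum_div_const

/-- RH-FREE. **Decay of a polar sum along the critical line**: `Σ c_n/(½ + is + 2(n+1)) → 0` as `|s| → ∞`
(dominated convergence). [cite: ConnesConsani2021QuasiInner, Prop 4.5 proof (arXiv chunk p0013:L47–L51)] -/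
theorem tendsto_archPolarSum_vertical {c : ℕ → ℂ} (hc : Summable fun n => ‖c n‖) :
    Tendsto (fun s : ℝ => ∑' n : ℕ, c n / ((((1 / 2 : ℝ) : ℂ) + s * I) + 2 * ((n : ℂ) + 1)))
      (cocompact ℝ) (𝓝 0) := by
  have hden1 : ∀ (s : ℝ) (n : ℕ), (1 : ℝ) ≤ ‖(((1 / 2 : ℝ) : ℂ) + s * I) + 2 * ((n : ℂ) + 1)‖ := by
    intro s n
    have h := abs_re_le_norm ((((1 / 2 : ℝ) : ℂ) + s * I) + 2 * ((n : ℂ) + 1))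
    have hre : ((((1 / 2 : ℝ) : ℂ) + s * I) + 2 * ((n : ℂ) + 1)).re = 1 / 2 + 2 * (n + 1) := by simp
    rw [hre] at h
    have : (1 : ℝ) ≤ |1 / 2 + 2 * ((n : ℝ) + 1)| := by rw [abs_of_pos (by positivity)]; linarith [n.cast_nonneg (α := ℝ)]
    linarith
  have h := tendsto_tsum_of_dominated_convergence (𝓕 := cocompact ℝ)
    (f := fun (s : ℝ) (n : ℕ) => c n / ((((1 / 2 : ℝ) : ℂ) + s * I) + 2 * ((n : ℂ) + 1)))
    (g := fun _ => (0 : ℂ)) (bound := fun n => ‖c n‖) hc ?_ ?_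
  · simpa using h
  · intro n
    have hden : Tendsto (fun s : ℝ => ‖(((1 / 2 : ℝ) : ℂ) + s * I) + 2 * ((n : ℂ) + 1)‖) (cocompact ℝ) atTop := by
      refine tendsto_atTop_mono (fun s => ?_) (tendsto_norm_cocompact_atTop (E := ℝ))
      have h := abs_im_le_norm ((((1 / 2 : ℝ) : ℂ) + s * I) + 2 * ((n : ℂ) + 1))
      simpa [Real.norm_eq_abs] using h
    have h0 : Tendsto (fun s : ℝ => ‖c n‖ * ‖(((1 / 2 : ℝ) : ℂ) + s * I) + 2 * ((n : ℂ) + 1)‖⁻¹)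
        (cocompact ℝ) (𝓝 0) := by
      have h := hden.inv_tendsto_atTop.const_mul ‖c n‖
      rw [mul_zero] at h
      exact h
    refine squeeze_zero_norm (fun s => ?_) h0
    rw [norm_div, div_eq_mul_inv]
  · refine Filter.Eventually.of_forall fun s n => ?_
    rw [norm_div]
    exact div_le_self (norm_nonneg _) (hden1 s n)

/-! ### C. Holomorphy of the `p`-polar part `φ` off its poles `2πin/log p`, `n ≠ 0`

t18's `QuasiInnerPrimePolarPart` proves domination of the terms of `φ` in boxes off the imaginary axis; here
we dominate them on small balls around ANY point which is not a pole (finitely many near poles by a positive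
minimal distance, the tail by `|n|^{−3/2}`), which gives holomorphy of `φ` on `ℂ ∖ {2πin/log p : n ≠ 0}` and the
removable behaviour of `φ` minus one term at that term's pole. -/

/-- RH-FREE. `0 ≤ A_p`. [folklore] -/
private theorem rhoArchPoleConst_nonneg' {p : ℕ} (hp : 1 < p) : 0 ≤ rhoArchPoleConst p := by
  have h := norm_rhoArch_primePole_le hp (n := 1) one_ne_zero
  simp only [Int.cast_one, abs_one, Real.one_rpow, mul_one] at h
  exact (norm_nonneg _).trans h

/-- RH-FREE. `n ↦ 2πin/log p` is injective. [cite: ConnesConsani2021QuasiInner, Lemma 3.1 (ii) (arXiv chunk p0008:L11)] -/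
theorem primePole_injective {p : ℕ} (hp : 1 < p) : Function.Injective (primePole p) := by
  intro m n h
  have hlog : 0 < Real.log p := Real.log_pos (by exact_mod_cast hp)
  have h1 := congrArg Complex.im h
  rw [primePole_im, primePole_im] at h1
  have h2 : (m : ℝ) = n := by
    have hπ : (0:ℝ) < 2 * π := by positivity
    field_simp at h1
    nlinarith [h1, hπ, hlog]
  exact_mod_cast h2

/-- RH-FREE. **Local domination of the terms of `φ`, one index `k` excluded**: around every point `z` which is not
a pole `2πim/log p` (`m ≠ 0, k`) there is a ball on which `Σ_{m ≠ k} ρ_∞(2πim/log p)/(w − 2πim/log p)` is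
holomorphic and absolutely convergent («`|ρ_∞(2πin/log p)| = O(n^{−1/2})` … this suffices to show that the series
defining `φ(z)` is absolutely convergent. The same holds for the series of derivatives», p0013:L11–L13).
[cite: ConnesConsani2021QuasiInner, Prop 4.5 proof (arXiv chunk p0013:L9–L13)] -/
theorem exists_ball_differentiableOn_primePolarSum_ite {p : ℕ} (hp : 1 < p) (z : ℂ) (k : ℤ)
    (hz : ∀ m : ℤ, m ≠ 0 → m ≠ k → z ≠ primePole p m) :
    ∃ r > 0, DifferentiableOn ℂ (fun w : ℂ => ∑' m : ℤ, if m = k then (0 : ℂ) else primePolarTerm p w m)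
        (ball z r) ∧
      ∀ w ∈ ball z r, Summable fun m : ℤ => if m = k then (0 : ℂ) else primePolarTerm p w m := by
  have hlog : 0 < Real.log p := Real.log_pos (by exact_mod_cast hp)
  set b : ℝ := 2 * π / Real.log p with hb
  have hb0 : 0 < b := by positivity
  set A : ℝ := rhoArchPoleConst p with hA
  have hA0 : 0 ≤ A := rhoArchPoleConst_nonneg' hp
  set M : ℝ := |z.im| + 1 with hM
  set N : ℕ := ⌈2 * M / b⌉₊ with hN
  set S : Finset ℤ := (Finset.Icc (-(N : ℤ)) N).filter (fun m => m ≠ 0 ∧ m ≠ k) with hS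
  obtain ⟨c₀, hc0, hc1, hcS⟩ := exists_pos_le_finset S (fun m => ‖z - primePole p m‖) (by
    intro m hm
    have h := (Finset.mem_filter.mp hm).2
    exact norm_pos_iff.mpr (sub_ne_zero.mpr (hz m h.1 h.2)))
  -- lower bounds for the denominators on the ball of radius `c₀/2`
  have hnear : ∀ m : ℤ, m ≠ 0 → m ≠ k → |m| ≤ (N : ℤ) → ∀ w ∈ ball z (c₀ / 2),
      c₀ / 2 ≤ ‖w - primePole p m‖ := by
    intro m hm0 hmk hmN w hw
    rw [mem_ball, dist_eq_norm] at hw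
    have h1 := hcS m (Finset.mem_filter.mpr ⟨Finset.mem_Icc.mpr (abs_le.mp hmN), hm0, hmk⟩)
    have h2 : ‖z - primePole p m‖ - ‖w - z‖ ≤ ‖w - primePole p m‖ := by
      have := norm_sub_norm_le (z - primePole p m) (z - w)
      rw [show z - primePole p m - (z - w) = w - primePole p m by ring] at this
      rw [norm_sub_rev w z]
      exact this
    linarith
  have hfar : ∀ m : ℤ, (N : ℤ) < |m| → ∀ w ∈ ball z (c₀ / 2), b * |(m : ℝ)| / 2 ≤ ‖w - primePole p m‖ := by
    intro m hmN w hw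
    rw [mem_ball, dist_eq_norm] at hw
    have hwim : |w.im| ≤ M := by
      have h1 : |w.im - z.im| ≤ ‖w - z‖ := by simpa using abs_im_le_norm (w - z)
      have h2 := abs_sub_abs_le_abs_sub w.im z.im
      rw [hM]; linarith
    have hmR : (N : ℝ) < |(m : ℝ)| := by rw [← Int.cast_abs]; exact_mod_cast hmN
    have hNdef : 2 * M / b ≤ N := Nat.le_ceil _
    have hbm : 2 * M ≤ b * |(m : ℝ)| := by
      have := (div_le_iff₀ hb0).mp (hNdef.trans hmR.le)
      linarith [mul_comm b |(m:ℝ)|]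
    have him : (w - primePole p m).im = w.im - b * m := by rw [sub_im, primePole_im, hb]; ring
    have h1 : |w.im - b * m| ≤ ‖w - primePole p m‖ := by rw [← him]; exact abs_im_le_norm _
    have h2 : b * |(m : ℝ)| - |w.im| ≤ |w.im - b * m| := by
      have := abs_sub_abs_le_abs_sub (b * m) w.im
      rw [abs_mul, abs_of_pos hb0, abs_sub_comm] at this
      exact this
    linarith
  -- the summable majorant
  set u : ℤ → ℝ := fun m => (if |m| ≤ (N : ℤ) then 2 * A / c₀ else 0) + 2 * A / b * |(m : ℝ)| ^ (-(3 / 2 : ℝ))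
    with hu
  have hu_sum : Summable u := by
    refine Summable.add ?_ ((Real.summable_abs_int_rpow (by norm_num)).mul_left _)
    refine summable_of_ne_finset_zero (s := Finset.Icc (-(N : ℤ)) N) fun m hm => ?_
    rw [Finset.mem_Icc, ← abs_le] at hm
    simp [hm]
  have hu_nonneg1 : ∀ m : ℤ, 0 ≤ (if |m| ≤ (N : ℤ) then 2 * A / c₀ else 0 : ℝ) := fun m => by
    split_ifs <;> positivity
  have hu_nonneg2 : ∀ m : ℤ, 0 ≤ 2 * A / b * |(m : ℝ)| ^ (-(3 / 2 : ℝ)) := fun m => by positivity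
  -- termwise bound
  have hbound : ∀ m : ℤ, ∀ w ∈ ball z (c₀ / 2),
      ‖(if m = k then (0 : ℂ) else primePolarTerm p w m)‖ ≤ u m := by
    intro m w hw
    by_cases hmk : m = k
    · simp only [hmk, if_true, norm_zero, hu]; exact add_nonneg (hu_nonneg1 k) (hu_nonneg2 k)
    simp only [hmk, if_false]
    by_cases hm0 : m = 0
    · rw [hm0, primePolarTerm_zero, norm_zero]; exact add_nonneg (hu_nonneg1 0) (hu_nonneg2 0)
    have hm1 : (1 : ℝ) ≤ |(m : ℝ)| := by rw [← Int.cast_abs]; exact_mod_cast Int.one_le_abs hm0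
    have hρ : ‖rhoArch (primePole p m)‖ ≤ A * |(m : ℝ)| ^ (-(1 / 2 : ℝ)) := norm_rhoArch_primePole_le hp hm0
    rw [primePolarTerm_of_ne_zero p w hm0, norm_div]
    by_cases hmN : |m| ≤ (N : ℤ)
    · have hd := hnear m hm0 hmk hmN w hw
      have hdpos : 0 < ‖w - primePole p m‖ := lt_of_lt_of_le (by positivity) hd
      have h1 : ‖rhoArch (primePole p m)‖ ≤ A := by
        refine hρ.trans ?_
        have : |(m : ℝ)| ^ (-(1 / 2 : ℝ)) ≤ 1 := Real.rpow_le_one_of_one_le_of_nonpos hm1 (by norm_num)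
        nlinarith
      calc ‖rhoArch (primePole p m)‖ / ‖w - primePole p m‖ ≤ A / (c₀ / 2) := by
            rw [div_le_div_iff₀ hdpos (by positivity)]
            nlinarith [norm_nonneg (rhoArch (primePole p m))]
        _ = 2 * A / c₀ := by field_simp
        _ ≤ u m := by simp only [hu, hmN, if_true]; linarith [hu_nonneg2 m]
    · push Not at hmN
      have hd := hfar m hmN w hw
      have hmpos : (0 : ℝ) < |(m : ℝ)| := by linarith
      have hdpos : 0 < ‖w - primePole p m‖ := lt_of_lt_of_le (by positivity) hd
      have e : |(m : ℝ)| ^ (-(1 / 2 : ℝ)) = |(m : ℝ)| ^ (-(3 / 2 : ℝ)) * |(m : ℝ)| := by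
        rw [show (-(1 / 2 : ℝ)) = -(3 / 2 : ℝ) + 1 by norm_num, Real.rpow_add hmpos, Real.rpow_one]
      calc ‖rhoArch (primePole p m)‖ / ‖w - primePole p m‖
          ≤ A * |(m : ℝ)| ^ (-(1 / 2 : ℝ)) / (b * |(m : ℝ)| / 2) := by
            rw [div_le_div_iff₀ hdpos (by positivity)]
            have := mul_le_mul hρ hd (by positivity) (by positivity)
            linarith
        _ = 2 * A / b * |(m : ℝ)| ^ (-(3 / 2 : ℝ)) := by rw [e]; field_simp
        _ ≤ u m := by simp only [hu]; linarith [hu_nonneg1 m]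
  refine ⟨c₀ / 2, by positivity, ?_, fun w hw => Summable.of_norm_bounded hu_sum (fun m => hbound m w hw)⟩
  refine differentiableOn_tsum_of_summable_norm (u := u) hu_sum (fun m => ?_) isOpen_ball hbound
  by_cases hmk : m = k
  · simp only [hmk, if_true]; exact differentiableOn_const _
  simp only [hmk, if_false]
  by_cases hm0 : m = 0
  · rw [hm0]; simp only [primePolarTerm_zero]; exact differentiableOn_const _
  simp only [primePolarTerm_of_ne_zero p _ hm0]
  apply DifferentiableOn.div (differentiableOn_const _) (differentiableOn_id.sub (differentiableOn_const _))
  intro w hw h0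
  by_cases hmN : |m| ≤ (N : ℤ)
  · have := hnear m hm0 hmk hmN w hw
    rw [h0, norm_zero] at this; linarith
  · push Not at hmN
    have := hfar m hmN w hw
    rw [h0, norm_zero] at this
    have hmpos : (0 : ℝ) < |(m : ℝ)| := by
      have : (N : ℝ) < |(m : ℝ)| := by rw [← Int.cast_abs]; exact_mod_cast hmN
      linarith [N.cast_nonneg (α := ℝ)]
    nlinarith

/-- RH-FREE. The terms of `φ` are absolutely summable at every point which is not a pole.
[cite: ConnesConsani2021QuasiInner, Prop 4.5 proof (arXiv chunk p0013:L11)] -/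
theorem summable_primePolarTerm_of_ne {p : ℕ} (hp : 1 < p) {z : ℂ} (hz : ∀ m : ℤ, m ≠ 0 → z ≠ primePole p m) :
    Summable (primePolarTerm p z) := by
  obtain ⟨r, hr, -, hsum⟩ := exists_ball_differentiableOn_primePolarSum_ite hp z 0 (fun m hm0 _ => hz m hm0)
  refine (hsum z (mem_ball_self hr)).congr fun m => ?_
  split_ifs with h
  · rw [h, primePolarTerm_zero]
  · rfl

/-- RH-FREE. **`φ` is holomorphic off its poles `2πin/log p` (`n ≠ 0`)** — in particular at `0` and at the poles
`−2n` of `ρ_∞`. [cite: ConnesConsani2021QuasiInner, Prop 4.5 proof (arXiv chunk p0013:L9–L13)] -/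
theorem differentiableAt_primePolarPart {p : ℕ} (hp : 1 < p) {z : ℂ} (hz : ∀ m : ℤ, m ≠ 0 → z ≠ primePole p m) :
    DifferentiableAt ℂ (primePolarPart p) z := by
  obtain ⟨r, hr, hdiff, -⟩ := exists_ball_differentiableOn_primePolarSum_ite hp z 0 (fun m hm0 _ => hz m hm0)
  have heq : (fun w : ℂ => ∑' m : ℤ, if m = 0 then (0 : ℂ) else primePolarTerm p w m) =
      fun w => ∑' m : ℤ, primePolarTerm p w m := by
    funext w
    refine tsum_congr fun m => ?_
    split_ifs with h
    · rw [h, primePolarTerm_zero]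
    · rfl
  have h1 : DifferentiableAt ℂ (fun w : ℂ => ∑' m : ℤ, primePolarTerm p w m) z := by
    rw [← heq]; exact hdiff.differentiableAt (isOpen_ball.mem_nhds (mem_ball_self hr))
  have e : primePolarPart p = fun w => (1 - (p : ℂ)⁻¹) / Real.log p * ∑' m : ℤ, primePolarTerm p w m := rfl
  rw [e]
  exact h1.const_mul _

/-- RH-FREE. **Removable behaviour of `φ` minus its `k`-th term at the pole `2πik/log p`** (`k ≠ 0`).
[cite: ConnesConsani2021QuasiInner, Prop 4.5 proof (arXiv chunk p0013:L9–L13)] -/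
theorem exists_tendsto_primePolarPart_sub {p : ℕ} (hp : 1 < p) {k : ℤ} (hk : k ≠ 0) :
    ∃ L : ℂ, Tendsto (fun w : ℂ => primePolarPart p w -
        (1 - (p : ℂ)⁻¹) / Real.log p * (rhoArch (primePole p k) / (w - primePole p k)))
      (𝓝[≠] (primePole p k)) (𝓝 L) := by
  set q : ℂ := primePole p k with hq
  have hqm : ∀ m : ℤ, m ≠ 0 → m ≠ k → q ≠ primePole p m := fun m _ hmk h =>
    hmk (primePole_injective hp h).symm
  obtain ⟨r, hr, hdiff, hsum⟩ := exists_ball_differentiableOn_primePolarSum_ite hp q k hqm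
  have hball : ball q r ∈ 𝓝 q := isOpen_ball.mem_nhds (mem_ball_self hr)
  set G : ℂ → ℂ := fun w => ∑' m : ℤ, if m = k then (0 : ℂ) else primePolarTerm p w m with hG
  have hGc : ContinuousAt G q := (hdiff.differentiableAt hball).continuousAt
  refine ⟨(1 - (p : ℂ)⁻¹) / Real.log p * G q,
    ((hGc.tendsto.mono_left nhdsWithin_le_nhds).const_mul ((1 - (p : ℂ)⁻¹) / Real.log p)).congr' ?_⟩
  filter_upwards [mem_nhdsWithin_of_mem_nhds hball] with w hw
  have hs : Summable (Function.update (primePolarTerm p w) k 0) := by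
    refine (hsum w hw).congr fun m => ?_
    rw [Function.update_apply]
  have hsplit := Summable.tsum_eq_add_tsum_ite' k hs
  simp only [hG]
  rw [primePolarPart, hsplit, primePolarTerm_of_ne_zero p w hk]
  ring

/-- RH-FREE. **`φ` is bounded on the critical line** (continuity + «`φ(½ + is) = O(|s|^{−1/2} log|s|)`»).
[cite: ConnesConsani2021QuasiInner, Prop 4.5 proof (arXiv chunk p0013:L13–L33)] -/
theorem exists_norm_primePolarPart_half_le {p : ℕ} (hp : 1 < p) :
    ∃ C : ℝ, ∀ s : ℝ, ‖primePolarPart p (((1 / 2 : ℝ) : ℂ) + s * I)‖ ≤ C := by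
  refine exists_bound_of_tendsto_cocompact ?_ (tendsto_primePolarPart_vertical hp (by norm_num))
  refine continuous_iff_continuousAt.mpr fun s => ?_
  have hc : ContinuousAt (primePolarPart p) (((1 / 2 : ℝ) : ℂ) + s * I) :=
    continuousAt_primePolarPart hp (by simp)
  have h2 : Continuous fun s : ℝ => (((1 / 2 : ℝ) : ℂ) + s * I) := by fun_prop
  exact ContinuousAt.comp (g := primePolarPart p) (f := fun s : ℝ => (((1 / 2 : ℝ) : ℂ) + s * I)) hc
    h2.continuousAt

/-! ### D. The poles of `ρ_∞ρ_p`: «three kinds» (p0011:L104) — principal parts and removable remainders -/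

/-- RH-FREE. **At a pole `2πik/log p` (`k ≠ 0`) of `ρ_p`**: `ρ_∞ρ_p − ((1 − p⁻¹)/log p)·ρ_∞(2πik/log p)/(z − 2πik/log p)`
has a limit («the residues are, for the simple poles, multiplied by the value of the other factor at the point …
one multiplies the residue by `ρ_∞(2πin/log p)`»; residue of `ρ_p` = `(1 − p⁻¹)/log p`, t17's
`tendsto_sub_mul_rhoPrime_pole`, t5's `exists_pole_structure_rhoPrime_zero` + periodicity).
[cite: ConnesConsani2021QuasiInner, Thm 4.4 (ii) proof (arXiv chunk p0011:L104–p0012:L2); Prop 4.5 proof, first display (p0013:L9)] -/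
theorem exists_tendsto_product_sub_primePole {p : ℕ} (hp : 1 < p) {k : ℤ} (hk : k ≠ 0) :
    ∃ L : ℂ, Tendsto (fun z : ℂ => rhoArch z * rhoPrime p z -
        (1 - (p : ℂ)⁻¹) / Real.log p * (rhoArch (primePole p k) / (z - primePole p k)))
      (𝓝[≠] (primePole p k)) (𝓝 L) := by
  have hlog : 0 < Real.log p := Real.log_pos (by exact_mod_cast hp)
  set q : ℂ := primePole p k with hq
  obtain ⟨ψ, V, hV, -, hψd, hψ0, hψ⟩ := exists_pole_structure_rhoPrime_zero hp
  have hqim : q.im ≠ 0 := by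
    rw [hq, primePole_im]
    have : (2 * π * (k : ℝ)) ≠ 0 := mul_ne_zero (by positivity) (Int.cast_ne_zero.mpr hk)
    exact div_ne_zero this hlog.ne'
  have hρd : DifferentiableAt ℂ rhoArch q := differentiableAt_rhoArch_of_im_ne_zero hqim
  have hψ0d : DifferentiableAt ℂ ψ 0 := hψd.differentiableAt hV
  have hψq : DifferentiableAt ℂ (fun z : ℂ => ψ (z - q)) q := by
    have h1 : DifferentiableAt ℂ (fun z : ℂ => z - q) q := differentiableAt_id.sub_const q
    have h2 : DifferentiableAt ℂ ψ ((fun z : ℂ => z - q) q) := by simp only [sub_self]; exact hψ0d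
    exact DifferentiableAt.comp (g := ψ) (f := fun z : ℂ => z - q) q h2 h1
  set g : ℂ → ℂ := fun z => rhoArch z * ψ (z - q) with hg
  have hgd : DifferentiableAt ℂ g q := hρd.mul hψq
  -- the periodicity `ρ_p(z) = ρ_p(z − q)`, `q = k·(2πi/log p)`
  have hper : ∀ z : ℂ, rhoPrime p z = rhoPrime p (z - q) := by
    intro z
    have h := (rhoPrime_periodic hp).sub_int_mul_eq k (x := z)
    rw [show (k : ℂ) * (2 * π * I / Real.log p) = q by rw [hq, primePole]; ring] at h
    exact h.symm
  have hF : ∀ᶠ z in 𝓝[≠] q, rhoArch z * rhoPrime p z = g z / (z - q) := by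
    have h1 : ∀ᶠ z in 𝓝 q, z - q ∈ V := by
      have : Tendsto (fun z : ℂ => z - q) (𝓝 q) (𝓝 0) := by
        simpa using (continuous_sub_right q).tendsto q
      exact this hV
    filter_upwards [mem_nhdsWithin_of_mem_nhds h1, self_mem_nhdsWithin] with z hzV hzq
    have hzq' : z - q ≠ 0 := sub_ne_zero.mpr hzq
    rw [hper z, hψ (z - q) hzV hzq', hg]
    ring
  refine ⟨deriv g q, (hasDerivAt_iff_tendsto_slope.mp hgd.hasDerivAt).congr' ?_⟩
  filter_upwards [hF, self_mem_nhdsWithin] with z hz hzq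
  have hzq' : z - q ≠ 0 := sub_ne_zero.mpr hzq
  rw [slope_def_field, hz]
  have hgq : g q = rhoArch q * ((1 - (p : ℂ)⁻¹) / Real.log p) := by rw [hg]; simp [hψ0]
  rw [hgq]
  ring

open scoped Nat in
/-- RH-FREE. **At a pole `−2k` (`k ≥ 1`) of `ρ_∞`**: `ρ_∞ρ_p − r_k ρ_p(−2k)/(z + 2k)` has a limit, `r_k = Res_{−2k}ρ_∞
= (−1)^k 2√π π^{2k}/(k! Γ(k+½))` («this multiplies the residue by `ρ_p(−2n)`»; t17's `exists_rhoArch_eq_div_sub_pole`).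
[cite: ConnesConsani2021QuasiInner, Thm 4.4 (ii) proof (arXiv chunk p0012:L2–L7); Prop 4.5 proof, display φ₁ first expression (p0013:L47–L48)] -/
theorem exists_tendsto_product_sub_archPole {p : ℕ} (hp : 1 < p) {k : ℕ} (hk : 1 ≤ k) :
    ∃ L : ℂ, Tendsto (fun z : ℂ => rhoArch z * rhoPrime p z -
        ((((-1 : ℝ) ^ k * 2 * (Real.sqrt π * π ^ (2 * k)) / (k ! * Real.Gamma (k + 1 / 2)) : ℝ)) : ℂ) *
          rhoPrime p (-(2 * (k : ℂ))) / (z - -(2 * (k : ℂ))))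
      (𝓝[≠] (-(2 * (k : ℂ)))) (𝓝 L) := by
  set q : ℂ := -(2 * (k : ℂ)) with hq
  obtain ⟨Φ, hΦd, hΦv, hΦF⟩ := exists_rhoArch_eq_div_sub_pole k
  have hqre : q.re ≠ 0 := by
    rw [hq]; simp
    have : (1 : ℝ) ≤ k := by exact_mod_cast hk
    linarith
  have hρpd : DifferentiableAt ℂ (rhoPrime p) q := differentiableAt_rhoPrime hp hqre
  have hball : ball q 1 ∈ 𝓝 q := isOpen_ball.mem_nhds (mem_ball_self one_pos)
  set g : ℂ → ℂ := fun z => Φ z * rhoPrime p z with hg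
  have hgd : DifferentiableAt ℂ g q := (hΦd.differentiableAt hball).mul hρpd
  have hF : ∀ᶠ z in 𝓝[≠] q, rhoArch z * rhoPrime p z = g z / (z - q) := by
    filter_upwards [mem_nhdsWithin_of_mem_nhds hball, self_mem_nhdsWithin] with z hz hzq
    rw [hΦF z hz hzq, hg]
    ring
  refine ⟨deriv g q, (hasDerivAt_iff_tendsto_slope.mp hgd.hasDerivAt).congr' ?_⟩
  filter_upwards [hF, self_mem_nhdsWithin] with z hz hzq
  have hzq' : z - q ≠ 0 := sub_ne_zero.mpr hzq
  rw [slope_def_field, hz]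
  have hgq : g q = ((((-1 : ℝ) ^ k * 2 * (Real.sqrt π * π ^ (2 * k)) / (k ! * Real.Gamma (k + 1 / 2)) : ℝ)) : ℂ) *
      rhoPrime p q := by rw [hg]; simp only; rw [hΦv]
  rw [hgq]
  ring

/-- RH-FREE. **The double pole at `0`**: for suitable `a, b` (in print `a = 2(p−1)/(p log p)` and the `γ, Γ′/Γ(½)`
constant `b`, display φ₂, p0013:L50), `ρ_∞ρ_p − a/z² − b/z` has a limit at `0` (`z²ρ_∞ρ_p` is holomorphic at `0`;
two divided differences). [cite: ConnesConsani2021QuasiInner, Prop 4.5 proof, display φ₂ (arXiv chunk p0013:L49–L50); Thm 4.4 (ii) proof (p0012:L8–L18)] -/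
theorem exists_tendsto_product_sub_doublePole {p : ℕ} (hp : 1 < p) :
    ∃ a b L : ℂ, Tendsto (fun z : ℂ => rhoArch z * rhoPrime p z - a / z ^ 2 - b / z) (𝓝[≠] 0) (𝓝 L) := by
  obtain ⟨Φ, hΦd, -, hΦF⟩ := exists_rhoArch_eq_div_sub_pole 0
  have hc0 : (-(2 * ((0 : ℕ) : ℂ)) : ℂ) = 0 := by simp
  rw [hc0] at hΦd hΦF
  obtain ⟨ψ, V, hV, -, hψd, -, hψ⟩ := exists_pole_structure_rhoPrime_zero hp
  set U : Set ℂ := ball (0 : ℂ) 1 ∩ V with hU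
  have hUn : U ∈ 𝓝 (0 : ℂ) := inter_mem (isOpen_ball.mem_nhds (mem_ball_self one_pos)) hV
  set G : ℂ → ℂ := fun z => Φ z * ψ z with hG
  have hGd : DifferentiableOn ℂ G U := (hΦd.mono inter_subset_left).mul (hψd.mono inter_subset_right)
  set G₁ : ℂ → ℂ := dslope G 0 with hG₁
  have hG₁d : DifferentiableOn ℂ G₁ U := (differentiableOn_dslope hUn).mpr hGd
  set G₂ : ℂ → ℂ := dslope G₁ 0 with hG₂
  have hG₂d : DifferentiableOn ℂ G₂ U := (differentiableOn_dslope hUn).mpr hG₁d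
  have hG₂c : ContinuousAt G₂ 0 := (hG₂d.differentiableAt hUn).continuousAt
  refine ⟨G 0, G₁ 0, G₂ 0, (hG₂c.tendsto.mono_left nhdsWithin_le_nhds).congr' ?_⟩
  filter_upwards [mem_nhdsWithin_of_mem_nhds hUn, self_mem_nhdsWithin] with z hzU hz0
  have e1 : (z - 0) • G₁ z = G z - G 0 := sub_smul_dslope G 0 z
  have e2 : (z - 0) • G₂ z = G₁ z - G₁ 0 := sub_smul_dslope G₁ 0 z
  rw [sub_zero, smul_eq_mul] at e1 e2
  have hF : rhoArch z * rhoPrime p z = G z / z ^ 2 := by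
    rw [hΦF z hzU.1 hz0, hψ z hzU.2 hz0, hG, sub_zero]
    field_simp
  rw [hF]
  have hz0' : (z : ℂ) ≠ 0 := hz0
  field_simp
  linear_combination z * e2 + e1

/-! ### E. The set of poles, the remainder `E = ρ_∞ρ_p − (φ + φ₁ + φ₂)` and its entire extension -/

/-- RH-FREE. `½ ≤ |½ − 2k|` for every integer `k` (the vertical sides `Re z = ½ − 2m` of `C_{R,m}` stay at distance
`≥ ½` from the poles `2ℤ`). [folklore] -/
private theorem half_le_abs_half_sub_two_mul (k : ℤ) : (1 / 2 : ℝ) ≤ |1 / 2 - 2 * (k : ℝ)| := by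
  rcases le_or_gt k 0 with h | h
  · have : (k : ℝ) ≤ 0 := by exact_mod_cast h
    rw [abs_of_nonneg (by linarith)]; linarith
  · have : (1 : ℝ) ≤ k := by exact_mod_cast h
    rw [abs_of_neg (by linarith)]; linarith

/-- RH-FREE. **The poles of `ρ_∞ρ_p` in `ℂ` are uniformly separated** («the poles are of three kinds …»): any two
distinct points of `{−2n : n ∈ ℕ} ∪ {2πin/log p : n ∈ ℤ}` are at distance `≥ min(2, 2π/log p)`.
[cite: ConnesConsani2021QuasiInner, Thm 4.4 (ii) proof (arXiv chunk p0011:L104)] -/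
theorem pairwise_dist_poles {p : ℕ} (hp : 1 < p) :
    {z : ℂ | (∃ n : ℕ, z = -(2 * (n : ℂ))) ∨ ∃ m : ℤ, z = primePole p m}.Pairwise
      (fun x y => min 2 (2 * π / Real.log p) ≤ dist x y) := by
  have hlog : 0 < Real.log p := Real.log_pos (by exact_mod_cast hp)
  set b : ℝ := 2 * π / Real.log p with hb
  have hb0 : 0 < b := by positivity
  -- distance estimates
  have hAA : ∀ n n' : ℕ, n ≠ n' → (2 : ℝ) ≤ dist (-(2 * (n : ℂ))) (-(2 * (n' : ℂ))) := by
    intro n n' h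
    rw [dist_eq_norm, show (-(2 * (n : ℂ)) - -(2 * (n' : ℂ))) = (((2 * ((n' : ℝ) - n)) : ℝ) : ℂ) by push_cast; ring,
      Complex.norm_real, Real.norm_eq_abs, abs_mul, abs_two]
    have : (1 : ℝ) ≤ |(n' : ℝ) - n| := by
      rcases Nat.lt_or_gt_of_ne h with hlt | hlt
      · have : (n : ℝ) + 1 ≤ n' := by exact_mod_cast hlt
        rw [abs_of_nonneg (by linarith)]; linarith
      · have : (n' : ℝ) + 1 ≤ n := by exact_mod_cast hlt
        rw [abs_of_neg (by linarith)]; linarith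
    linarith
  have hBB : ∀ m m' : ℤ, m ≠ m' → b ≤ dist (primePole p m) (primePole p m') := by
    intro m m' h
    rw [dist_eq_norm]
    have h1 : |(primePole p m - primePole p m').im| ≤ ‖primePole p m - primePole p m'‖ := abs_im_le_norm _
    rw [sub_im, primePole_im, primePole_im, show 2 * π * (m : ℝ) / Real.log p - 2 * π * m' / Real.log p =
      b * ((m : ℝ) - m') by rw [hb]; ring, abs_mul, abs_of_pos hb0] at h1
    have : (1 : ℝ) ≤ |(m : ℝ) - m'| := by
      rw [← Int.cast_sub, ← Int.cast_abs]; exact_mod_cast Int.one_le_abs (sub_ne_zero.mpr h)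
    nlinarith
  have hAB : ∀ (n : ℕ) (m : ℤ), (-(2 * (n : ℂ))) ≠ primePole p m →
      min 2 b ≤ dist (-(2 * (n : ℂ))) (primePole p m) := by
    intro n m h
    rw [dist_eq_norm]
    rcases Nat.eq_zero_or_pos n with rfl | hn
    · -- `0` versus `2πim/log p`, `m ≠ 0`
      have hm : m ≠ 0 := by
        rintro rfl; apply h; simp [primePole]
      have e : (-(2 * ((0:ℕ) : ℂ)) - primePole p m) = -primePole p m := by simp
      rw [e, norm_neg]
      have h1 : |(primePole p m).im| ≤ ‖primePole p m‖ := abs_im_le_norm _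
      rw [primePole_im, show 2 * π * (m : ℝ) / Real.log p = b * m by rw [hb]; ring, abs_mul,
        abs_of_pos hb0] at h1
      have : (1 : ℝ) ≤ |(m : ℝ)| := by rw [← Int.cast_abs]; exact_mod_cast Int.one_le_abs hm
      exact (min_le_right _ _).trans (by nlinarith)
    · have h1 : |(-(2 * (n : ℂ)) - primePole p m).re| ≤ ‖-(2 * (n : ℂ)) - primePole p m‖ := abs_re_le_norm _
      rw [sub_re, primePole_re] at h1
      simp only [neg_re, sub_zero] at h1
      have h2 : ((2 : ℂ) * (n : ℂ)).re = 2 * n := by simp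
      rw [h2, abs_neg, abs_of_pos (by positivity)] at h1
      have : (1 : ℝ) ≤ n := by exact_mod_cast hn
      exact (min_le_left _ _).trans (by linarith)
  intro x hx y hy hxy
  rcases hx with ⟨n, rfl⟩ | ⟨m, rfl⟩ <;> rcases hy with ⟨n', rfl⟩ | ⟨m', rfl⟩
  · exact (min_le_left _ _).trans (hAA n n' (fun h => hxy (by rw [h])))
  · exact hAB n m' hxy
  · rw [dist_comm]; exact hAB n' m (Ne.symm hxy)
  · exact (min_le_right _ _).trans (hBB m m' (fun h => hxy (by rw [h])))

/-- RH-FREE. The set of poles of `ρ_∞ρ_p` is closed. [cite: ConnesConsani2021QuasiInner, Thm 4.4 (ii) proof (arXiv chunk p0011:L104)] -/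
theorem isClosed_poles {p : ℕ} (hp : 1 < p) :
    IsClosed {z : ℂ | (∃ n : ℕ, z = -(2 * (n : ℂ))) ∨ ∃ m : ℤ, z = primePole p m} := by
  have hlog : 0 < Real.log p := Real.log_pos (by exact_mod_cast hp)
  exact Metric.isClosed_of_pairwise_le_dist (lt_min two_pos (by positivity)) (pairwise_dist_poles hp)

/-- RH-FREE. Every pole of `ρ_∞ρ_p` is isolated. [cite: ConnesConsani2021QuasiInner, Thm 4.4 (ii) proof (arXiv chunk p0011:L104)] -/
theorem eventually_notMem_poles {p : ℕ} (hp : 1 < p) {z : ℂ}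
    (hz : z ∈ {z : ℂ | (∃ n : ℕ, z = -(2 * (n : ℂ))) ∨ ∃ m : ℤ, z = primePole p m}) :
    ∀ᶠ w in 𝓝[≠] z, w ∉ {z : ℂ | (∃ n : ℕ, z = -(2 * (n : ℂ))) ∨ ∃ m : ℤ, z = primePole p m} := by
  have hlog : 0 < Real.log p := Real.log_pos (by exact_mod_cast hp)
  have hε : 0 < min 2 (2 * π / Real.log p) := lt_min two_pos (by positivity)
  filter_upwards [mem_nhdsWithin_of_mem_nhds (ball_mem_nhds z hε), self_mem_nhdsWithin] with w hw hwz
  intro hwP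
  have h := pairwise_dist_poles hp hz hwP (Ne.symm hwz)
  rw [mem_ball, dist_comm] at hw
  linarith

/-- RH-FREE. Off the poles every factor and every polar part is holomorphic: `ρ_∞` (t17), `ρ_p` (t5), `φ`, the
polar sums at `−2(n+1)`, and `z⁻²`, `z⁻¹`. [cite: ConnesConsani2021QuasiInner, Prop 4.5 proof «k … by construction holomorphic in 𝒰» (arXiv chunk p0013:L50–L52)] -/
theorem differentiableAt_productRemainder {p : ℕ} (hp : 1 < p) {c : ℕ → ℂ} (hc : Summable fun n => ‖c n‖)
    (a b : ℂ) {z : ℂ} (hz : z ∉ {z : ℂ | (∃ n : ℕ, z = -(2 * (n : ℂ))) ∨ ∃ m : ℤ, z = primePole p m}) :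
    DifferentiableAt ℂ (fun w : ℂ => rhoArch w * rhoPrime p w -
      (primePolarPart p w + ∑' n : ℕ, c n / (w + 2 * ((n : ℂ) + 1)) + (a * w⁻¹ ^ 2 + b * w⁻¹ ^ 1))) z := by
  simp only [Set.mem_setOf_eq, not_or, not_exists] at hz
  obtain ⟨hzA, hzB⟩ := hz
  have h1 : DifferentiableAt ℂ rhoArch z := by
    refine differentiableAt_rhoArch fun h => ?_
    obtain ⟨n, hn⟩ := Complex.Gammaℝ_eq_zero_iff.mp h
    exact hzA n (by rw [hn])
  have h2 : DifferentiableAt ℂ (rhoPrime p) z := by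
    refine differentiableAt_rhoPrime_of_ne hp fun h => ?_
    obtain ⟨m, hm⟩ := (natCast_cpow_neg_eq_one_iff hp z).mp (sub_eq_zero.mp h).symm
    exact hzB m (by rw [hm, primePole])
  have h3 : DifferentiableAt ℂ (primePolarPart p) z := differentiableAt_primePolarPart hp fun m _ => hzB m
  have h4 : DifferentiableAt ℂ (fun w : ℂ => ∑' n : ℕ, c n / (w + 2 * ((n : ℂ) + 1))) z :=
    differentiableAt_archPolarSum hc fun n h => hzA (n + 1) (by rw [h]; push_cast; ring)
  have hz0 : z ≠ 0 := fun h => hzA 0 (by rw [h]; simp)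
  have h5 : DifferentiableAt ℂ (fun w : ℂ => a * w⁻¹ ^ 2 + b * w⁻¹ ^ 1) z :=
    ((differentiableAt_const a).mul ((differentiableAt_inv hz0).pow 2)).add
      ((differentiableAt_const b).mul ((differentiableAt_inv hz0).pow 1))
  exact (h1.mul h2).sub ((h3.add h4).add h5)

/-! ### F. Uniform bounds on the printed rectangles `C_{R,m}`, `R = (2m′+1)π/log p`

«The absolute value of `φ₁(z)` (and of `φ₂(z)`) on the contour `C_{R,m}` … with `R = (2m+1)π/log p` is bounded
independently of `m` since `|z + 2n| ≥ ½` … To obtain a uniform bound for `|φ(z)|` on `C_{R,m}` one uses Hölder's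
inequality» (p0013:L51–L52; the `φ`-bounds are t18's `norm_primePolarPart_le_of_one_le_abs_re` /
`norm_primePolarPart_le_of_im_half_lattice`), `|ρ_∞| ≤ C` on `ℂ₋` off `2ℤ`-neighbourhoods (`exists_norm_rhoArch_le`),
`|ρ_p| ≤ 1` on the half-lattice lines and the critical line, `≤ (1+p⁻¹)/(p^{3/2}−1)` on `Re z ≤ −3/2` (t5, t17). -/

/-- RH-FREE. `‖a z⁻² + b z⁻¹‖ ≤ 4‖a‖ + 2‖b‖` for `‖z‖ ≥ ½`. [folklore] -/
private theorem norm_doublePolePart_le (a b : ℂ) {z : ℂ} (hz : (1 / 2 : ℝ) ≤ ‖z‖) :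
    ‖a * z⁻¹ ^ 2 + b * z⁻¹ ^ 1‖ ≤ 4 * ‖a‖ + 2 * ‖b‖ := by
  have hz0 : 0 < ‖z‖ := lt_of_lt_of_le (by norm_num) hz
  have hi : ‖z‖⁻¹ ≤ 2 := by rw [inv_le_comm₀ hz0 two_pos]; linarith
  have h1 : ‖a * z⁻¹ ^ 2‖ ≤ 4 * ‖a‖ := by
    rw [norm_mul, norm_pow, norm_inv]
    have hi2 : ‖z‖⁻¹ ^ 2 ≤ 2 ^ 2 := pow_le_pow_left₀ (inv_nonneg.mpr hz0.le) hi 2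
    calc ‖a‖ * ‖z‖⁻¹ ^ 2 ≤ ‖a‖ * 2 ^ 2 := mul_le_mul_of_nonneg_left hi2 (norm_nonneg a)
      _ = 4 * ‖a‖ := by ring
  have h2 : ‖b * z⁻¹ ^ 1‖ ≤ 2 * ‖b‖ := by
    rw [pow_one, norm_mul, norm_inv]
    calc ‖b‖ * ‖z‖⁻¹ ≤ ‖b‖ * 2 := mul_le_mul_of_nonneg_left hi (norm_nonneg b)
      _ = 2 * ‖b‖ := by ring
  exact (norm_add_le _ _).trans (add_le_add h1 h2)

/-- RH-FREE. **The remainder `E = ρ_∞ρ_p − (φ + φ₁ + φ₂)` is bounded on the boundaries of the printed rectangles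
`(½ − 2m, ½) × (−(2m′+1)π/log p, (2m′+1)π/log p)`, uniformly in `m ≥ 1`, `m′ ≥ log p`** (and the boundary carries
no pole). [cite: ConnesConsani2021QuasiInner, Prop 4.5 proof (arXiv chunk p0013:L50–L52); Thm 4.4 (ii) proof «the same contour … R = (2m+1)π/log p» (p0011:L102–L104)] -/
theorem exists_bound_productRemainder_frontier {p : ℕ} (hp : p.Prime) {c : ℕ → ℂ}
    (hc : Summable fun n => ‖c n‖) (a b : ℂ) :
    ∃ C : ℝ, ∀ (m m' : ℕ), 1 ≤ m → Real.log p ≤ m' →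
      ∀ z ∈ frontier (Set.Ioo (1 / 2 - 2 * (m : ℝ)) (1 / 2) ×ℂ
          Set.Ioo (-((2 * (m' : ℝ) + 1) * π / Real.log p)) ((2 * (m' : ℝ) + 1) * π / Real.log p)),
        z ∉ {z : ℂ | (∃ n : ℕ, z = -(2 * (n : ℂ))) ∨ ∃ m : ℤ, z = primePole p m} ∧
        ‖rhoArch z * rhoPrime p z -
          (primePolarPart p z + ∑' n : ℕ, c n / (z + 2 * ((n : ℂ) + 1)) + (a * z⁻¹ ^ 2 + b * z⁻¹ ^ 1))‖ ≤ C := by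
  have hp1 : 1 < p := hp.one_lt
  have hp2 : (2 : ℝ) ≤ p := by exact_mod_cast hp.two_le
  have hlog : 0 < Real.log p := Real.log_pos (by exact_mod_cast hp1)
  obtain ⟨CA, hCA0, hCA⟩ := exists_norm_rhoArch_le (δ := 1 / 2) (by norm_num)
  obtain ⟨Cv, hCv⟩ := norm_primePolarPart_le_of_one_le_abs_re hp1
  obtain ⟨Ch, hCh⟩ := norm_primePolarPart_le_of_im_half_lattice hp1
  obtain ⟨Cr, hCr⟩ := exists_norm_primePolarPart_half_le hp1
  set CP : ℝ := max 1 ((1 + (p : ℝ)⁻¹) / ((p : ℝ) ^ (3 / 2 : ℝ) - 1)) with hCP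
  set Cφ : ℝ := |Cv| + |Ch| + |Cr| with hCφ
  set S : ℝ := ∑' n : ℕ, ‖c n‖ with hS
  have hS0 : 0 ≤ S := tsum_nonneg fun n => norm_nonneg _
  refine ⟨CA * CP + Cφ + S / (1 / 2) + (4 * ‖a‖ + 2 * ‖b‖), fun m m' hm hm' z hz => ?_⟩
  set T : ℝ := (2 * (m' : ℝ) + 1) * π / Real.log p with hT
  have hT0 : 0 < T := by positivity
  have hT1 : (1 / 2 : ℝ) ≤ T := by
    rw [hT, le_div_iff₀ hlog]
    have : Real.log p * 1 ≤ (m' : ℝ) * π := by nlinarith [Real.pi_gt_three, hm']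
    nlinarith [Real.pi_gt_three]
  have hm1 : (1 : ℝ) ≤ m := by exact_mod_cast hm
  -- the key estimate from the side conditions
  have key : z.re ≤ 1 / 2 → (∀ j : ℤ, (1 / 2 : ℝ) ≤ ‖z - 2 * j‖) → ‖rhoPrime p z‖ ≤ CP →
      ‖primePolarPart p z‖ ≤ Cφ → (∀ n : ℕ, (1 / 2 : ℝ) ≤ ‖z + 2 * ((n : ℂ) + 1)‖) → (1 / 2 : ℝ) ≤ ‖z‖ →
      ‖rhoArch z * rhoPrime p z -
          (primePolarPart p z + ∑' n : ℕ, c n / (z + 2 * ((n : ℂ) + 1)) + (a * z⁻¹ ^ 2 + b * z⁻¹ ^ 1))‖ ≤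
        CA * CP + Cφ + S / (1 / 2) + (4 * ‖a‖ + 2 * ‖b‖) := by
    intro hre hj hρp hφ hden hzn
    have h1 : ‖rhoArch z * rhoPrime p z‖ ≤ CA * CP := by
      rw [norm_mul]
      exact mul_le_mul (hCA z hre hj) hρp (norm_nonneg _) hCA0
    have h2 := norm_archPolarSum_le hc (by norm_num : (0:ℝ) < 1 / 2) hden
    have h3 := norm_doublePolePart_le a b hzn
    calc _ ≤ ‖rhoArch z * rhoPrime p z‖ +
          ‖primePolarPart p z + ∑' n : ℕ, c n / (z + 2 * ((n : ℂ) + 1)) + (a * z⁻¹ ^ 2 + b * z⁻¹ ^ 1)‖ :=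
          norm_sub_le _ _
      _ ≤ ‖rhoArch z * rhoPrime p z‖ + (‖primePolarPart p z‖ + ‖∑' n : ℕ, c n / (z + 2 * ((n : ℂ) + 1))‖ +
          ‖a * z⁻¹ ^ 2 + b * z⁻¹ ^ 1‖) := by
          gcongr
          exact norm_add₃_le
      _ ≤ _ := by linarith
  have hCP1 : (1 : ℝ) ≤ CP := le_max_left _ _
  have hCPl : (1 + (p : ℝ)⁻¹) / ((p : ℝ) ^ (3 / 2 : ℝ) - 1) ≤ CP := le_max_right _ _
  have hCv' : ∀ w : ℂ, 1 ≤ |w.re| → ‖primePolarPart p w‖ ≤ Cφ := fun w hw =>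
    (hCv w hw).trans (by rw [hCφ]; linarith [le_abs_self Cv, abs_nonneg Ch, abs_nonneg Cr])
  have hCh' : ∀ (w : ℂ) (k : ℤ), w.im = (2 * k + 1) * π / Real.log p → ‖primePolarPart p w‖ ≤ Cφ := fun w k hw =>
    (hCh w k hw).trans (by rw [hCφ]; linarith [le_abs_self Ch, abs_nonneg Cv, abs_nonneg Cr])
  have hCr' : ∀ s : ℝ, ‖primePolarPart p (((1 / 2 : ℝ) : ℂ) + s * I)‖ ≤ Cφ := fun s =>
    (hCr s).trans (by rw [hCφ]; linarith [le_abs_self Cr, abs_nonneg Cv, abs_nonneg Ch])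
  -- unpack the frontier
  have hab : (1 / 2 - 2 * (m : ℝ)) < 1 / 2 := by linarith
  have hTT : -T < T := by linarith
  rw [frontier_reProdIm, closure_Ioo hab.ne, frontier_Ioo hTT, frontier_Ioo hab, closure_Ioo hTT.ne] at hz
  -- poles: real parts and imaginary parts
  have hpole_im : ∀ w : ℂ, (w.im = T ∨ w.im = -T) →
      w ∉ {z : ℂ | (∃ n : ℕ, z = -(2 * (n : ℂ))) ∨ ∃ m : ℤ, z = primePole p m} := by
    intro w hw hP
    rcases hP with ⟨n, rfl⟩ | ⟨k, rfl⟩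
    · simp at hw
      rcases hw with h | h <;> linarith
    · rw [primePole_im] at hw
      have hk : (2 * (k : ℝ)) = 2 * m' + 1 ∨ (2 * (k : ℝ)) = -(2 * m' + 1) := by
        rcases hw with h | h
        · left; rw [hT] at h; field_simp at h; nlinarith [Real.pi_pos]
        · right; rw [hT] at h; field_simp at h; nlinarith [Real.pi_pos]
      rcases hk with h | h
      · have : (2 * k : ℤ) = 2 * (m' : ℤ) + 1 := by exact_mod_cast h
        omega
      · have : (2 * k : ℤ) = -(2 * (m' : ℤ) + 1) := by exact_mod_cast h
        omega
  have hpole_re : ∀ w : ℂ, (w.re = 1 / 2 - 2 * m ∨ w.re = 1 / 2) →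
      w ∉ {z : ℂ | (∃ n : ℕ, z = -(2 * (n : ℂ))) ∨ ∃ m : ℤ, z = primePole p m} := by
    intro w hw hP
    rcases hP with ⟨n, rfl⟩ | ⟨k, rfl⟩
    · simp at hw
      rcases hw with h | h
      · have : (-(2 * (n : ℤ)) : ℤ) * 2 = (1 - 4 * (m : ℤ)) := by
          have h' : (-(2 * (n : ℝ))) * 2 = 1 - 4 * (m : ℝ) := by linarith
          exact_mod_cast h'
        omega
      · linarith
    · rw [primePole_re] at hw
      rcases hw with h | h
      · have : (0 : ℤ) * 2 = 1 - 4 * (m : ℤ) := by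
          have h' : (0 : ℝ) * 2 = 1 - 4 * (m : ℝ) := by linarith
          exact_mod_cast h'
        omega
      · norm_num at h
  rcases hz with ⟨hre, him⟩ | ⟨hre, him⟩
  · -- horizontal sides: `Im z = ±T`
    rw [Set.mem_preimage, Set.mem_Icc] at hre
    rw [Set.mem_preimage] at him
    have him' : z.im = T ∨ z.im = -T := by
      rcases him with h | h
      · right; exact h
      · left; simpa using h
    have habsim : |z.im| = T := by
      rcases him' with h | h
      · rw [h, abs_of_pos hT0]
      · rw [h, abs_neg, abs_of_pos hT0]
    refine ⟨hpole_im z him', key hre.2 (fun j => ?_) ?_ ?_ (fun n => ?_) ?_⟩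
    · have := abs_im_le_norm (z - 2 * j)
      simp at this
      linarith
    · -- `|ρ_p| ≤ 1` on the half-lattice lines
      refine le_trans ?_ hCP1
      rcases him' with h | h
      · have hT' : ((2 * ((m' : ℤ) : ℝ) + 1) * π / Real.log p) = z.im := by rw [h, hT]; push_cast; ring
        have h1 := norm_rhoPrime_le_one_of_re_le_half hp1 (m' : ℤ) hre.2 (x := z.re)
        rwa [hT', Complex.re_add_im] at h1
      · have hT' : ((2 * (((-(m' : ℤ) - 1 : ℤ)) : ℝ) + 1) * π / Real.log p) = z.im := by
          rw [h, hT]; push_cast; ring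
        have h1 := norm_rhoPrime_le_one_of_re_le_half hp1 (-(m' : ℤ) - 1) hre.2 (x := z.re)
        rwa [hT', Complex.re_add_im] at h1
    · rcases him' with h | h
      · exact hCh' z m' (by rw [h, hT]; push_cast; ring)
      · exact hCh' z (-(m' : ℤ) - 1) (by rw [h, hT]; push_cast; ring)
    · have := abs_im_le_norm (z + 2 * ((n : ℂ) + 1))
      simp at this
      linarith
    · have := abs_im_le_norm z
      linarith
  · -- vertical sides: `Re z = ½ − 2m` or `Re z = ½`
    rw [Set.mem_preimage, Set.mem_Icc] at him
    rw [Set.mem_preimage] at hre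
    have hre' : z.re = 1 / 2 - 2 * m ∨ z.re = 1 / 2 := by
      rcases hre with h | h
      · left; exact h
      · right; simpa using h
    have hre2 : z.re ≤ 1 / 2 := by rcases hre' with h | h <;> linarith
    have habsre : (1 / 2 : ℝ) ≤ |z.re| := by
      rcases hre' with h | h
      · rw [h, abs_of_neg (by linarith)]; linarith
      · rw [h]; norm_num
    refine ⟨hpole_re z hre', key hre2 (fun j => ?_) ?_ ?_ (fun n => ?_) ((habsre.trans (abs_re_le_norm z)))⟩
    · have h1 := abs_re_le_norm (z - 2 * j)
      have h2 : (z - 2 * (j : ℂ)).re = z.re - 2 * j := by simp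
      rw [h2] at h1
      refine le_trans ?_ h1
      rcases hre' with h | h
      · rw [h, show (1 / 2 - 2 * (m : ℝ) - 2 * j) = 1 / 2 - 2 * (((m : ℤ) + j : ℤ) : ℝ) by push_cast; ring]
        exact half_le_abs_half_sub_two_mul _
      · rw [h]; exact half_le_abs_half_sub_two_mul j
    · rcases hre' with h | h
      · -- left side: Lemma 3.1 (iii) with `ε = 3/2`
        refine le_trans (norm_rhoPrime_le_of_re_le hp1 (ε := 3 / 2) (by norm_num) (by rw [h]; linarith)) hCPl
      · -- right side: `|ρ_p| = 1` on the critical line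
        have hz' : z = 1 / 2 + (z.im : ℂ) * I := by
          apply Complex.ext <;> simp [h]
        rw [hz', norm_rhoPrime_critical_line hp1 z.im]
        exact hCP1
    · rcases hre' with h | h
      · exact hCv' z (by rw [h, abs_of_neg (by linarith)]; linarith)
      · have hz' : z = ((1 / 2 : ℝ) : ℂ) + (z.im : ℂ) * I := by
          apply Complex.ext <;> simp [h]
        rw [hz']; exact hCr' z.im
    · have h1 := abs_re_le_norm (z + 2 * ((n : ℂ) + 1))
      have h2 : (z + 2 * ((n : ℂ) + 1)).re = z.re + 2 * (n + 1) := by simp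
      rw [h2] at h1
      refine le_trans ?_ h1
      rcases hre' with h | h
      · rw [h, show (1 / 2 - 2 * (m : ℝ) + 2 * ((n : ℝ) + 1)) = 1 / 2 - 2 * (((m : ℤ) - n - 1 : ℤ) : ℝ) by
          push_cast; ring]
        exact half_le_abs_half_sub_two_mul _
      · rw [h, abs_of_pos (by positivity)]; linarith [n.cast_nonneg (α := ℝ)]

/-! ### G. The coefficients of `φ₁` and the discharge of Proposition 4.5 -/

open scoped Nat in
/-- RH-FREE. **The coefficients `ρ_p(−2n)·Res_{−2n}ρ_∞` of the polar part `φ₁` are absolutely summable** (in fact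
`O(π^{2n}/(n−1)!)`: `|Res_{−2n}ρ_∞| = (4n+1)|thm23Coeff n| ≤ (4n+1)·4√π π^{2n}/n!`, `|ρ_p(−2n)| ≤ 1`).
NOTE on print: the SECOND expression of display φ₁ (p0013:L48–L49) carries the operator normalisation `(4n+1)^{−1}`
and the sign of (4.3); the polar part is the FIRST expression `Σ ρ_p(−2n)·(√π 2π^{2n}(−1)^n/(Γ(n+1)Γ(n+½)))·(z+2n)^{−1}`,
which is what is used here. [cite: ConnesConsani2021QuasiInner, Prop 4.5 proof, display φ₁ (arXiv chunk p0013:L47–L49)] -/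
theorem summable_norm_archProductPolarCoeff {p : ℕ} (hp : p.Prime) :
    Summable fun n : ℕ => ‖((((-1 : ℝ) ^ (n + 1) * 2 * (Real.sqrt π * π ^ (2 * (n + 1))) /
        ((n + 1) ! * Real.Gamma ((n + 1 : ℕ) + 1 / 2)) : ℝ)) : ℂ) * rhoPrime p (-(2 * ((n + 1 : ℕ) : ℂ)))‖ := by
  have hp1 : 1 < p := hp.one_lt
  have hp2 : (2 : ℝ) ≤ p := by exact_mod_cast hp.two_le
  have hρle : ∀ k : ℕ, 1 ≤ k → ‖rhoPrime p (-(2 * (k : ℂ)))‖ ≤ 1 := by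
    intro k hk
    have hk1 : (1 : ℝ) ≤ k := by exact_mod_cast hk
    have hre : (-(2 * (k : ℂ))).re ≤ -2 := by simp; linarith
    refine (norm_rhoPrime_le_of_re_le hp1 (ε := 2) two_pos hre).trans ?_
    have hpow : (p : ℝ) ^ (2 : ℝ) = (p : ℝ) ^ 2 := Real.rpow_two _
    rw [hpow, div_le_one (by nlinarith)]
    have : (p : ℝ)⁻¹ ≤ 1 := inv_le_one_of_one_le₀ (by linarith)
    nlinarith
  have hr : ∀ k : ℕ, ((-1 : ℝ) ^ k * 2 * (Real.sqrt π * π ^ (2 * k)) / (k ! * Real.Gamma (k + 1 / 2))) =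
      -(4 * k + 1) * thm23Coeff k := by
    intro k
    rw [thm23Coeff, Real.Gamma_nat_eq_factorial]
    have hG : Real.Gamma ((k : ℝ) + 1 / 2) ≠ 0 := (Real.Gamma_pos_of_pos (by positivity)).ne'
    have h4 : (4 * (k : ℝ) + 1) ≠ 0 := by positivity
    field_simp
    ring
  refine Summable.of_nonneg_of_le (fun n => norm_nonneg _) (fun n => ?_)
    ((Real.summable_pow_div_factorial (π ^ 2)).mul_left (20 * Real.sqrt π * π ^ 2))
  rw [norm_mul, Complex.norm_real, Real.norm_eq_abs]
  have e : ((((n + 1 : ℕ) : ℝ)) + 1 / 2) = ((n + 1 : ℕ) : ℝ) + 1 / 2 := rfl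
  rw [show ((-1 : ℝ) ^ (n + 1) * 2 * (Real.sqrt π * π ^ (2 * (n + 1))) / ((n + 1) ! * Real.Gamma ((n + 1 : ℕ) + 1 / 2)))
      = -(4 * ((n + 1 : ℕ) : ℝ) + 1) * thm23Coeff (n + 1) from hr (n + 1), abs_mul, abs_neg,
    abs_of_pos (by positivity : (0:ℝ) < 4 * ((n + 1 : ℕ) : ℝ) + 1)]
  have h1 := abs_thm23Coeff_le (n + 1)
  have h2 := hρle (n + 1) (by omega)
  have hn1 : (0 : ℝ) < (n : ℝ) + 1 := by positivity
  have hX : 0 ≤ Real.sqrt π * (π ^ 2) ^ n / n ! := by positivity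
  calc (4 * ((n + 1 : ℕ) : ℝ) + 1) * |thm23Coeff (n + 1)| * ‖rhoPrime p (-(2 * ((n + 1 : ℕ) : ℂ)))‖
      ≤ (4 * ((n + 1 : ℕ) : ℝ) + 1) * (4 * Real.sqrt π * (π ^ 2) ^ (n + 1) / (n + 1) !) * 1 := by
        gcongr
    _ = (4 * ((n : ℝ) + 1) + 1) / ((n : ℝ) + 1) * (4 * π ^ 2 * (Real.sqrt π * (π ^ 2) ^ n / n !)) := by
        rw [Nat.factorial_succ]; push_cast
        field_simp
        ring
    _ ≤ 5 * (4 * π ^ 2 * (Real.sqrt π * (π ^ 2) ^ n / n !)) := by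
        gcongr
        rw [div_le_iff₀ hn1]; linarith
    _ = 20 * Real.sqrt π * π ^ 2 * ((π ^ 2) ^ n / n !) := by ring

open scoped Nat in
/-- RH-FREE. **Connes–Consani JNT 2021 Proposition 4.5 — DISCHARGED: `κκ_p ∈ C(S¹) + H^∞(𝒰)` for every prime `p`.**
Proof (the printed architecture, p0013:L7–L52, in the `z`-plane): the polar part
`Φ := φ + φ₁ + φ₂` of `ρ_∞ρ_p` (the three kinds of poles: `2πin/log p`, `n ≠ 0` — t18's `primePolarPart`; `−2n`,
`n ≥ 1` — the polar sum with coefficients `ρ_p(−2n)·Res_{−2n}ρ_∞`; the double pole at `0`) leaves a remainder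
`E = ρ_∞ρ_p − Φ` with removable singularities only (§§ C–E), i.e. an ENTIRE function `Ẽ`; `h := Ẽ∘ψ` is holomorphic on
the disc; it is BOUNDED there by the maximum modulus principle on the printed rectangles `C_{R,m}`,
`R = (2m′+1)π/log p`, whose boundaries carry uniform bounds (§ F; declared deviation from print, which concludes
through the vanishing of the negative Fourier modes, `H²` and the Cauchy integral); `c := Φ∘ψ` on `S¹` (value `0`
at `v = 1`) is continuous and `1`-periodic by t18's pullback principle `continuous_circlePullback` (φ and `z⁻ᵏ` by
t18, the polar sum at `−2(n+1)` by § B); the radial limits hold at every `e^{2πix} ≠ 1` by continuity of `Ẽ∘ψ`.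
The double-pole coefficients `(a, b)` are the true Laurent data at `0` (`exists_tendsto_product_sub_doublePole`);
the typed statement quantifies `c` existentially, so no identification with the printed `γ, Γ′/Γ(½)` constant is
needed. [cite: ConnesConsani2021QuasiInner, Prop 4.5 + proof (arXiv chunk p0013:L5–L52)] -/
theorem prop_4_5_holds : prop_4_5 := by
  intro p hp
  have hp1 : 1 < p := hp.one_lt
  have hp2 : 2 ≤ p := hp.two_le
  have hlog : 0 < Real.log p := Real.log_pos (by exact_mod_cast hp1)
  classical
  -- the coefficients of `φ₁` and the double-pole data
  set c : ℕ → ℂ := fun n => ((((-1 : ℝ) ^ (n + 1) * 2 * (Real.sqrt π * π ^ (2 * (n + 1))) /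
        ((n + 1) ! * Real.Gamma ((n + 1 : ℕ) + 1 / 2)) : ℝ)) : ℂ) * rhoPrime p (-(2 * ((n + 1 : ℕ) : ℂ))) with hc
  have hc_sum : Summable fun n => ‖c n‖ := summable_norm_archProductPolarCoeff hp
  obtain ⟨a, b, L₀, hL₀⟩ := exists_tendsto_product_sub_doublePole hp1
  set Φ : ℂ → ℂ := fun z => primePolarPart p z + ∑' n : ℕ, c n / (z + 2 * ((n : ℂ) + 1)) +
    (a * z⁻¹ ^ 2 + b * z⁻¹ ^ 1) with hΦ
  set E : ℂ → ℂ := fun z => rhoArch z * rhoPrime p z - Φ z with hE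
  set P : Set ℂ := {z : ℂ | (∃ n : ℕ, z = -(2 * (n : ℂ))) ∨ ∃ m : ℤ, z = primePole p m} with hP
  have hPc : IsClosed P := isClosed_poles hp1
  have hEd : ∀ z, z ∉ P → DifferentiableAt ℂ E z := fun z hz =>
    differentiableAt_productRemainder hp1 hc_sum a b hz
  -- continuity of the pieces of `Φ` off their poles
  have hPsum_cont : ∀ z : ℂ, (∀ n : ℕ, z ≠ -(2 * ((n : ℂ) + 1))) →
      ContinuousAt (fun w : ℂ => ∑' n : ℕ, c n / (w + 2 * ((n : ℂ) + 1))) z := fun z hz =>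
    (differentiableAt_archPolarSum hc_sum hz).continuousAt
  have hφ₂_cont : ∀ z : ℂ, z ≠ 0 → ContinuousAt (fun w : ℂ => a * w⁻¹ ^ 2 + b * w⁻¹ ^ 1) z := fun z hz =>
    (continuousAt_const.mul ((continuousAt_id.inv₀ hz).pow 2)).add
      (continuousAt_const.mul ((continuousAt_id.inv₀ hz).pow 1))
  -- (E1) the limits of `E` at the poles `−2n`, `n ∈ ℕ`
  have hlimA : ∀ n : ℕ, ∃ L : ℂ, Tendsto E (𝓝[≠] (-(2 * (n : ℂ)))) (𝓝 L) := by
    intro n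
    rcases Nat.eq_zero_or_pos n with rfl | hn
    · -- the double pole at `0`
      have h0 : (-(2 * ((0 : ℕ) : ℂ)) : ℂ) = 0 := by simp
      rw [h0]
      have hφc : ContinuousAt (primePolarPart p) 0 :=
        (differentiableAt_primePolarPart hp1 (z := 0) (fun m hm h => hm (primePole_injective hp1
          (by rw [← h]; simp [primePole])))).continuousAt
      have hSc : ContinuousAt (fun w : ℂ => ∑' n : ℕ, c n / (w + 2 * ((n : ℂ) + 1))) 0 :=
        hPsum_cont 0 (fun n h => by
          have := congrArg Complex.re h
          simp at this; linarith [n.cast_nonneg (α := ℝ)])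
      refine ⟨L₀ - primePolarPart p 0 - ∑' n : ℕ, c n / (0 + 2 * ((n : ℂ) + 1)), ?_⟩
      have h := (hL₀.sub (hφc.tendsto.mono_left nhdsWithin_le_nhds)).sub
        (hSc.tendsto.mono_left nhdsWithin_le_nhds)
      refine h.congr' ?_
      filter_upwards [self_mem_nhdsWithin] with z hz
      have hz0 : z ≠ 0 := hz
      simp only [hE, hΦ, inv_pow, pow_one]
      field_simp
      ring
    · obtain ⟨k, rfl⟩ : ∃ k, n = k + 1 := ⟨n - 1, by omega⟩
      obtain ⟨L₁, hL₁⟩ := exists_tendsto_product_sub_archPole hp1 (k := k + 1) (by omega)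
      obtain ⟨L₂, hL₂⟩ := exists_tendsto_archPolarSum_sub hc_sum k
      have hpt : (-(2 * (((k + 1 : ℕ)) : ℂ))) = -(2 * ((k : ℂ) + 1)) := by push_cast; ring
      rw [hpt] at hL₁ ⊢
      have hre : (-(2 * ((k : ℂ) + 1))).re ≠ 0 := by
        simp; linarith [k.cast_nonneg (α := ℝ)]
      have hφc : ContinuousAt (primePolarPart p) (-(2 * ((k : ℂ) + 1))) := continuousAt_primePolarPart hp1 hre
      have hne0 : (-(2 * ((k : ℂ) + 1))) ≠ 0 := fun h => hre (by rw [h]; simp)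
      have hφ₂c := hφ₂_cont _ hne0
      refine ⟨L₁ - L₂ - primePolarPart p (-(2 * ((k : ℂ) + 1))) -
        (a * (-(2 * ((k : ℂ) + 1)))⁻¹ ^ 2 + b * (-(2 * ((k : ℂ) + 1)))⁻¹ ^ 1), ?_⟩
      have h := ((hL₁.sub hL₂).sub (hφc.tendsto.mono_left nhdsWithin_le_nhds)).sub
        (hφ₂c.tendsto.mono_left nhdsWithin_le_nhds)
      refine h.congr' (Filter.Eventually.of_forall fun z => ?_)
      simp only [hE, hΦ, hc]
      push_cast
      ring
  -- (E2) the limits of `E` at the poles `2πik/log p`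
  have hlimB : ∀ k : ℤ, ∃ L : ℂ, Tendsto E (𝓝[≠] (primePole p k)) (𝓝 L) := by
    intro k
    rcases eq_or_ne k 0 with rfl | hk
    · have h0 : primePole p 0 = -(2 * ((0 : ℕ) : ℂ)) := by simp [primePole]
      rw [h0]; exact hlimA 0
    · obtain ⟨L₁, hL₁⟩ := exists_tendsto_product_sub_primePole hp1 hk
      obtain ⟨L₂, hL₂⟩ := exists_tendsto_primePolarPart_sub hp1 hk
      have hre0 : (primePole p k).re = 0 := primePole_re p k
      have hSc := hPsum_cont (primePole p k) (fun n h => by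
        have := congrArg Complex.re h
        rw [hre0] at this; simp at this; linarith [n.cast_nonneg (α := ℝ)])
      have hne0 : primePole p k ≠ 0 := fun h => hk (primePole_injective hp1 (by rw [h]; simp [primePole]))
      have hφ₂c := hφ₂_cont _ hne0
      refine ⟨L₁ - L₂ - (∑' n : ℕ, c n / (primePole p k + 2 * ((n : ℂ) + 1))) -
        (a * (primePole p k)⁻¹ ^ 2 + b * (primePole p k)⁻¹ ^ 1), ?_⟩
      have h := ((hL₁.sub hL₂).sub (hSc.tendsto.mono_left nhdsWithin_le_nhds)).sub
        (hφ₂c.tendsto.mono_left nhdsWithin_le_nhds)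
      refine h.congr' (Filter.Eventually.of_forall fun z => ?_)
      simp only [hE, hΦ]
      ring
  have hlim : ∀ z ∈ P, ∃ L : ℂ, Tendsto E (𝓝[≠] z) (𝓝 L) := by
    rintro z (⟨n, rfl⟩ | ⟨k, rfl⟩)
    · exact hlimA n
    · exact hlimB k
  -- (E3) the entire extension `Ẽ`
  set Et : ℂ → ℂ := P.piecewise (fun z => limUnder (𝓝[≠] z) E) E with hEt
  have hEq : ∀ z, z ∉ P → Et =ᶠ[𝓝 z] E := by
    intro z hz
    filter_upwards [hPc.isOpen_compl.mem_nhds hz] with u hu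
    exact Set.piecewise_eq_of_notMem _ _ _ hu
  have hEt_diff : Differentiable ℂ Et := by
    intro z
    by_cases hz : z ∈ P
    · obtain ⟨L, hL⟩ := hlim z hz
      have hiso := eventually_notMem_poles hp1 hz
      have hev : ∀ᶠ u in 𝓝[≠] z, Et u = E u := hiso.mono fun u hu => Set.piecewise_eq_of_notMem _ _ _ hu
      have hzv : Et z = L := by rw [hEt, Set.piecewise_eq_of_mem _ _ _ hz]; exact hL.limUnder_eq
      have hcont : ContinuousAt Et z := by
        rw [← continuousWithinAt_compl_self, ContinuousWithinAt, hzv]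
        exact hL.congr' (hev.mono fun u hu => hu.symm)
      have hd : ∀ᶠ u in 𝓝[≠] z, DifferentiableAt ℂ Et u :=
        hiso.mono fun u hu => (hEd u hu).congr_of_eventuallyEq (hEq u hu)
      exact (Complex.analyticAt_of_differentiable_on_punctured_nhds_of_continuousAt hd hcont).differentiableAt
    · exact (hEd z hz).congr_of_eventuallyEq (hEq z hz)
  -- (E4) the uniform bound on `Re z ≤ ½` (maximum modulus on the printed rectangles)
  obtain ⟨C, hC⟩ := exists_bound_productRemainder_frontier hp hc_sum a b
  have hbound : ∀ z : ℂ, z.re ≤ 1 / 2 → ‖Et z‖ ≤ C := by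
    intro z hz
    set m : ℕ := ⌈|z.re|⌉₊ + 1 with hm
    set m' : ℕ := ⌈Real.log p⌉₊ * (⌈|z.im|⌉₊ + 1) with hm'
    have hm1 : 1 ≤ m := by omega
    have hlogle : Real.log p ≤ m' := by
      rw [hm']; push_cast
      have h1 : Real.log p ≤ ⌈Real.log p⌉₊ := Nat.le_ceil _
      have h2 : (1 : ℝ) ≤ (⌈|z.im|⌉₊ : ℝ) + 1 := by linarith [Nat.cast_nonneg (α := ℝ) ⌈|z.im|⌉₊]
      nlinarith [hlog]
    set T : ℝ := (2 * (m' : ℝ) + 1) * π / Real.log p with hT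
    have hreL : 1 / 2 - 2 * (m : ℝ) ≤ z.re := by
      rw [hm]; push_cast
      have := Nat.le_ceil |z.re|
      have := neg_abs_le z.re
      linarith
    have himT : |z.im| ≤ T := by
      rw [hT, le_div_iff₀ hlog]
      have h1 : |z.im| ≤ ⌈|z.im|⌉₊ := Nat.le_ceil _
      have h2 : Real.log p ≤ ⌈Real.log p⌉₊ := Nat.le_ceil _
      have h4 : |z.im| * Real.log p ≤ (⌈|z.im|⌉₊ : ℝ) * ⌈Real.log p⌉₊ :=
        mul_le_mul h1 h2 hlog.le (Nat.cast_nonneg _)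
      have h5 : (⌈|z.im|⌉₊ : ℝ) * ⌈Real.log p⌉₊ ≤ m' := by
        rw [hm']; push_cast
        nlinarith [Nat.cast_nonneg (α := ℝ) ⌈Real.log p⌉₊, Nat.cast_nonneg (α := ℝ) ⌈|z.im|⌉₊]
      have h6 : (m' : ℝ) ≤ (2 * (m' : ℝ) + 1) * π := by nlinarith [Real.pi_gt_three, Nat.cast_nonneg (α := ℝ) m']
      linarith
    have hmem : z ∈ closure (Set.Ioo (1 / 2 - 2 * (m : ℝ)) (1 / 2) ×ℂ Set.Ioo (-T) T) := by
      have hab : (1 / 2 - 2 * (m : ℝ)) ≠ 1 / 2 := by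
        have : (1:ℝ) ≤ m := by exact_mod_cast hm1
        linarith
      have hT0 : 0 < T := by rw [hT]; positivity
      rw [closure_reProdIm, closure_Ioo hab, closure_Ioo (by linarith : (-T) ≠ T), mem_reProdIm]
      exact ⟨⟨hreL, hz⟩, abs_le.mp himT⟩
    refine Complex.norm_le_of_forall_mem_frontier_norm_le ((Metric.isBounded_Ioo _ _).reProdIm
      (Metric.isBounded_Ioo _ _)) hEt_diff.diffContOnCl (fun w hw => ?_) hmem
    obtain ⟨hwP, hwE⟩ := hC m m' hm1 hlogle w hw
    rw [hEt, Set.piecewise_eq_of_notMem _ _ _ hwP]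
    exact hwE
  -- the decomposition
  set h : ℂ → ℂ := fun v => Et (cayley v) with hh
  refine ⟨circlePullback Φ, h, ?_, circlePullback_periodic Φ, ?_, ⟨C, fun v hv => ?_⟩, ?_⟩
  · -- `c = Φ∘ψ ∈ C(S¹)`: t18's pullback principle
    refine continuous_circlePullback (fun z hz => ?_) ?_
    · have hz0 : z ≠ 0 := fun h => by rw [h, Complex.zero_re] at hz; norm_num at hz
      have h1 : ContinuousAt (primePolarPart p) z := continuousAt_primePolarPart hp1 (by rw [hz]; norm_num)
      have h2 := hPsum_cont z (fun n h => by
        have := congrArg Complex.re h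
        rw [hz] at this; simp at this; linarith [n.cast_nonneg (α := ℝ)])
      have h3 := hφ₂_cont z hz0
      exact (h1.add h2).add h3
    · have h := ((tendsto_primePolarPart_vertical hp1 (σ := 1 / 2) (by norm_num)).add
        (tendsto_archPolarSum_vertical hc_sum)).add
        (((tendsto_inv_pow_vertical (k := 2) (by norm_num)).const_mul a).add
          ((tendsto_inv_pow_vertical (k := 1) le_rfl).const_mul b))
      simp only [hΦ]
      simpa using h
  · -- `h` is holomorphic in the disc
    intro v hv
    have hv1 : v ≠ 1 := by
      intro h1; rw [h1, mem_ball_zero_iff, norm_one] at hv; exact lt_irrefl _ hv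
    exact ((hEt_diff _).comp v (differentiableAt_cayley hv1)).differentiableWithinAt
  · -- `h` is bounded
    exact hbound _ (re_cayley_le (le_of_lt (mem_ball_zero_iff.mp hv)))
  · -- radial limits at every `x ∉ ℤ`
    have hae : ∀ᵐ x : ℝ, x ∉ Set.range (Int.cast : ℤ → ℝ) :=
      measure_eq_zero_iff_ae_notMem.mp ((Set.countable_range _).measure_zero _)
    filter_upwards [hae] with x hx
    set w : ℂ := Complex.exp (2 * π * I * x) with hw
    have hw1 : w ≠ 1 := by
      intro h1
      rw [hw] at h1
      obtain ⟨k, hk⟩ := Complex.exp_eq_one_iff.mp h1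
      apply hx
      refine ⟨k, ?_⟩
      have h2 : (2 * π * I : ℂ) ≠ 0 := by simp [Real.pi_ne_zero, Complex.I_ne_zero]
      have h3 : (x : ℂ) * (2 * π * I) = (k : ℂ) * (2 * π * I) := by rw [← hk]; ring
      have h4 := mul_right_cancel₀ h2 h3
      exact_mod_cast h4.symm
    have hw_norm : ‖w‖ = 1 := by
      rw [hw, show (2 * π * I * x : ℂ) = ((2 * π * x : ℝ) : ℂ) * I by push_cast; ring]
      exact Complex.norm_exp_ofReal_mul_I _
    have hcw : cayley w ∉ P := by
      have hre : (cayley w).re = 1 / 2 := cayley_re_of_norm_eq_one hw_norm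
      rintro (⟨n, hn⟩ | ⟨m, hm⟩)
      · have := congrArg Complex.re hn
        rw [hre] at this; simp at this; linarith [n.cast_nonneg (α := ℝ)]
      · have := congrArg Complex.re hm
        rw [hre, primePole_re] at this; norm_num at this
    have hcont : ContinuousAt h w :=
      ContinuousAt.comp (g := Et) (f := cayley) (hEt_diff _).continuousAt
        (differentiableAt_cayley hw1).continuousAt
    have hpath : Tendsto (fun r : ℝ => (r : ℂ) * w) (𝓝[<] (1:ℝ)) (𝓝 w) := by
      have h0 : Continuous fun r : ℝ => (r : ℂ) * w := Complex.continuous_ofReal.mul continuous_const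
      have h1 := h0.tendsto 1
      simp only [Complex.ofReal_one, one_mul] at h1
      exact h1.mono_left nhdsWithin_le_nhds
    have hlimh : Tendsto (fun r : ℝ => h ((r : ℂ) * w)) (𝓝[<] (1:ℝ)) (𝓝 (h w)) := hcont.tendsto.comp hpath
    have hval : h w = kappaArch w * kappaPrime p w - circlePullback Φ x := by
      have h1 : h w = E (cayley w) := by rw [hh]; simp only; rw [hEt, Set.piecewise_eq_of_notMem _ _ _ hcw]
      have h2 : circlePullback Φ x = Φ (cayley w) := by rw [circlePullback, if_neg (by rwa [hw] at hw1)]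
      rw [h1, h2, hE]
      simp only [kappaArch, kappaPrime]
    rw [hval] at hlimh
    exact hlimh

end QuasiInner

end Literature.NumberTheory.ConnesConsani2021

end
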